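import Summits.CriticalPhenomena.Ising3DConformalLimit.Theses.ReflectionTwin
import Summits.CriticalPhenomena.Ising3DConformalLimit.Theorems.ReflectionTwinTwinTransparencyTwinBoxMonotone
import Summits.CriticalPhenomena.Ising3DConformalLimit.Theorems.ReflectionTwinTwinTransparencySeamLebowitzIncrement
import Summits.CriticalPhenomena.Ising3DConformalLimit.Theorems.ReflectionTwinTwinTransparencyThresholdNotCut
import Summits.CriticalPhenomena.Ising3DConformalLimit.Theorems.ReflectionTwinTwinTransparencyReplicaLower
import Summits.CriticalPhenomena.Ising3DConformalLimit.Theorems.ReflectionTwinTwinTransparencyReplicaAllUpper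
import Summits.CriticalPhenomena.Ising3DConformalLimit.Theorems.ReflectionTwinTwinTransparencyReplicaLowerUniform
import Summits.CriticalPhenomena.Ising3DConformalLimit.Theorems.ReflectionTwinTwinTransparencyReplicaAllUpperUniform
import Summits.CriticalPhenomena.Ising3DConformalLimit.Theorems.TwinTransparency.Negative.WithoutOrderThreshold
import Summits.CriticalPhenomena.Ising3DConformalLimit.Theorems.HyperoctahedralRPLimitRotationInvariant
import Summits.CriticalPhenomena.Ising3DConformalLimit.Theorems.HyperoctahedralRPHRP2Rigidity
import Summits.CriticalPhenomena.Ising3DConformalLimit.Theorems.MoebiusLimitExists.Negative.ScaleRedundant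
import Summits.CriticalPhenomena.Ising3DConformalLimit.Theorems.MoebiusLimitExists.Negative.FreeTranslations
import Literature.Probability.LatticeModels.CriticalWickDichotomy
import Literature.Probability.LatticeModels.TwistedPlusExpect
import HarnessLib

/-!
# Crux `ReflectionTwin.TwinTransparency` (stmt-CriticalPhenomena-16905) — line `replica-mirror`, v4
# (lead `prover-line-stmt-CriticalPhenomena-16905-c1-0`, 2026-08-17; continues v3 of lead `…-16905-0` / strategist `…-cstrat-…-b1-0`)

STATUS FLAG (unchanged, read first). Since 2026-08-16T22:39Z the tree PROVES `IsRotationInvariant S` for every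
nice pointwise scaling limit of `criticalCorr 3` (`limitRotationInvariant_proof ∘ HRP2Rigidity_of`), and — §4 below,
sorry-free — EVERY datum `(ρ, S)` in the crux's range is nice on `NonCoincident` (tree theorems of
`MoebiusLimitExists/Negative/`), so `S_k ∘ θ = S_k` on non-coincident configurations for ALL data: the declared risk
"TT presupposes O(3)" is retired outright. Route ReflectionTwin's `closes` no longer needs this crux
(STRATEGY-CENSUS.md §0); what remains is defect physics about twinned crystals.

THE CUT (strategist, kept). Twin `TW(J)` and bulk `ℤ³` are the two Markov doubles of the half-crystal `H = {h ≤ 0}`;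
the REPLICA TWIN of `ℤ³` (resample the lower half-crystal `{h ≤ -1}` of a critical bulk sample given the rest, pair
old with new spins; `replicaFold`, no seam, no `J`) splits the crux EXACTLY:
`ρ^k twinCorr = ρ^k replicaFold + ρ^k (twinCorr − replicaFold)`.

STATE v4 (2026-08-17, lead c1 cycle 1). RESHAPE: every replica / defect stub is now stated as LOCALLY UNIFORM
convergence (`TendstoLocallyUniformlyOn … (𝓝[>] 0)` on an open piece of configuration space) — the form in which the
bulk hypothesis `HasPointwiseScalingLimit` is itself given — so the former equicontinuity stub S7
(`stub_twinEquicontinuityEven`, whose open content was a hypothesis-free lattice Harnack inequality for the twin,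
S7Audit.lean) DISAPPEARS: the composition glues the three open pieces all-below / all-above / mixed with
`TendstoLocallyUniformlyOn.union` and adds the defect part with `TendstoLocallyUniformlyOn.add`; no equicontinuity is
needed anywhere. LANDED under `Theorems/ReflectionTwinTwinTransparency*.lean` (`--supports stmt-CriticalPhenomena-16905`):
* S1 `stub_twinBoxMonotone` (p166827) — GKS: free twin boxes monotone in the volume and in `J ≥ 0`, `|·| ≤ 1`;
* S2 `stub_seamLebowitzIncrement` (p169671) — Lebowitz differential inequality in the SEAM coupling;
* S3 `stub_thresholdNotCut` (p170398) — every continuous threshold is PLANE-CRITICAL: `slabChi J* = ⊤`;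
* S4 `stub_replicaLower` (p170708), S5a `stub_replicaAllUpper` (p170823) — pointwise one-sided replica mirror (v3;
  superseded in the composition by their locally uniform upgrades S4u / S5au below, kept as checks).
* S4u `stub_replicaLowerUniform` (p172237), S5au `stub_replicaAllUpperUniform` (p172410) — the one-sided replica mirror in
  LOCALLY UNIFORM form (`.mono`/`.comp` with `θ` + `.congr` of the datum; `θ`-invariance of every datum).
REGISTERED v4 stubs still OPEN (§3, the only `sorry`s):
S5b′ `stub_responsePairing` (OPEN: `R`-invariance of the half-crystal response pairing in the limit) and its factorisation bridge
S5b″ `stub_mixedOfResponsePairing` (provable: tower + pull-out; replaces v4's S5b-u `stub_replicaMirrorMixedUniform`),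
S6-u `stub_twinIsReplicaEvenUniform` (OPEN, hardest, held by the lead: plane-law universality at the threshold).
PROVED IN THIS FILE: the trivial orders `k = 0` and odd `k`; openness of the configuration pieces; the composition.
Composition `TwinTransparency_of` (no `sorry`): `A := LinearMap.id`; `PlaneCritical J` from S3 ∘ (S1, S2) and the
threshold; `k = 0` and odd `k` directly; even `k ≥ 2`: replica part on three open pieces (S4u / S5au / S5b-u) glued by
`.union`, plus the defect part (S6-u) by `.add`; `twinTransparency_iff` (`Iff.rfl` over the named closed terms)
concludes the route decl BY NAME.

Disproof used: `Disproof.lean` (cdisprove v4, 2026-08-17T16:10Z): §2 double existence shield (any `¬TT` proves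
TwinThreshold and datum existence), §3 load-bearing clauses `0 < J` / `∀ J' > J, LRO J'` (witness `J = 0` kills the
threshold-free mutation; `Negative/WithoutOrderThreshold.lean` p168222, whose flip lemma `gibbsAvg_eq_zero_of_flipOn`
is reused here for odd orders), §4 stub verdicts (S1–S4 true, S5–S7 open & shielded, no `stub-false`/`stub-misstated`),
§5 presearch of the kill criterion (non-trivial `ℤ₂ × θ`-symmetric interface: none in print). Negatives index: nothing
on twins/replicas. Dead lines: none.
-/

noncomputable section

namespace Summit.CriticalPhenomena.Ising3DConformalLimit.Cruxes.TwinTransparency.ReplicaMirror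

open scoped BigOperators Topology Manifold Classical MeasureTheory ProbabilityTheory Matrix InnerProductSpace ComplexConjugate ContinuousMap
open Filter Set Function TopologicalSpace MeasureTheory
open Literature.Probability.LatticeModels
open Summit.CriticalPhenomena.Ising3DConformalLimit.Theorems.TwinTransparency.Negative (gibbsAvg_eq_zero_of_flipOn spinAt_flipOn)

/-! ## §1 The twin and replica objects as NAMED CLOSED TERMS (proof-internal; no stub statement mentions these names) -/

/-- `ℝ³`. [folklore] -/
abbrev E : Type := EuclideanSpace ℝ (Fin 3)

/-- The Euclidean reflection `θ` in the twin plane `x₀+x₁+x₂ = 0`, as a closed term. [folklore] -/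
def thetaC : E → E := (fun v : EuclideanSpace ℝ (Fin 3) => ((ℝ ∙ (EuclideanSpace.single 0 1 + EuclideanSpace.single 1 1 + EuclideanSpace.single 2 1 : EuclideanSpace ℝ (Fin 3)))ᗮ).reflection v)

/-- Free-box twin correlator `⟨∏ᵢ σ_{zᵢ}⟩_{TW(J), box L}` (junk factor `0` off the box), closed term. [cite: FriedliVelenik2017, §3.1] -/
def twinBoxC : ℝ → ℕ → (k : ℕ) → (Fin k → Site 3) → ℝ := (fun (J : ℝ) (L : ℕ) (k : ℕ) (z : Fin k → Site 3) => PairIsing.gibbsAvg (fun a b : ↥(box 3 L) => if (((∑ i, |a.1 i - b.1 i| = 1) ∧ ¬ ((a.1 0 + a.1 1 + a.1 2 = 0 ∧ b.1 0 + b.1 1 + b.1 2 = 1) ∨ (a.1 0 + a.1 1 + a.1 2 = 1 ∧ b.1 0 + b.1 1 + b.1 2 = 0))) ∨ (((a.1 0 + a.1 1 + a.1 2 = 0 ∧ b.1 0 + b.1 1 + b.1 2 = 1) ∨ (a.1 0 + a.1 1 + a.1 2 = 1 ∧ b.1 0 + b.1 1 + b.1 2 = 0)) ∧ ∃ i : Fin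 3, a.1 + b.1 = Pi.single i 1)) then (criticalBeta 3 / 2) * (if a.1 0 + a.1 1 + a.1 2 = 0 ∨ b.1 0 + b.1 1 + b.1 2 = 0 then J else 1) else 0) (fun s => ∏ i, if h : z i ∈ box 3 L then spinAt (⟨z i, h⟩ : ↥(box 3 L)) s else 0))

/-- Sup-over-boxes twin correlator `twinLat` of the crux, closed term (verbatim TwinThreshold's `twinLatC`). [cite: FriedliVelenik2017, §3.1] -/
def twinLatC : ℝ → (k : ℕ) → (Fin k → Site 3) → ℝ := (fun (J : ℝ) (k : ℕ) (z : Fin k → Site 3) => ⨆ L : ℕ, PairIsing.gibbsAvg (fun a b : ↥(box 3 L) => if (((∑ i, |a.1 i - b.1 i| = 1) ∧ ¬ ((a.1 0 + a.1 1 + a.1 2 = 0 ∧ b.1 0 + b.1 1 + b.1 2 = 1) ∨ (a.1 0 + a.1 1 + a.1 2 = 1 ∧ b.1 0 + b.1 1 + b.1 2 = 0))) ∨ (((a.1 0 + a.1 1 + a.1 2 = 0 ∧ b.1 0 + b.1 1 + b.1 2 = 1) ∨ (a.1 0 + a.1 1 + a.1 2 = 1 ∧ b.1 0 + b.1 1 +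 b.1 2 = 0)) ∧ ∃ i : Fin 3, a.1 + b.1 = Pi.single i 1)) then (criticalBeta 3 / 2) * (if a.1 0 + a.1 1 + a.1 2 = 0 ∨ b.1 0 + b.1 1 + b.1 2 = 0 then J else 1) else 0) (fun s => ∏ i, if h : z i ∈ box 3 L then spinAt (⟨z i, h⟩ : ↥(box 3 L)) s else 0))

/-- Twin site of a continuum point at mesh `δ`, closed term. [folklore] -/
def siteC : ℝ → E → Site 3 := (fun (δ : ℝ) (v : EuclideanSpace ℝ (Fin 3)) => if v 0 + v 1 + v 2 ≤ 0 then latticeApprox δ v else -latticeApprox δ ((fun v : EuclideanSpace ℝ (Fin 3) => ((ℝ ∙ (EuclideanSpace.single 0 1 + EuclideanSpace.single 1 1 + EuclideanSpace.single 2 1 : EuclideanSpace ℝ (Fin 3)))ᗮ).reflection v) v))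

/-- Twin `k`-point function of a continuum configuration at mesh `δ`, closed term. [folklore] -/
def twinCorrC : ℝ → ℝ → (k : ℕ) → (Fin k → E) → ℝ := (fun (J δ : ℝ) (k : ℕ) (w : Fin k → EuclideanSpace ℝ (Fin 3)) => (fun (J : ℝ) (k : ℕ) (z : Fin k → Site 3) => ⨆ L : ℕ, PairIsing.gibbsAvg (fun a b : ↥(box 3 L) => if (((∑ i, |a.1 i - b.1 i| = 1) ∧ ¬ ((a.1 0 + a.1 1 + a.1 2 = 0 ∧ b.1 0 + b.1 1 + b.1 2 = 1) ∨ (a.1 0 + a.1 1 + a.1 2 = 1 ∧ b.1 0 + b.1 1 + b.1 2 = 0))) ∨ (((a.1 0 + a.1 1 + a.1 2 = 0 ∧ b.1 0 + b.1 1 + b.1 2 = 1) ∨ (a.1 0 + a.1 1 + a.1 2 = 1 ∧ b.1 0 + b.1 1 + b.1 2 = 0)) ∧ ∃ i : Fin 3, a.1 + b.1 = Pi.single i 1)) then (criticalBeta 3 / 2) * (if a.1 0 + a.1 1 + a.1 2 = 0 ∨ b.1 0 + b.1 1 + b.1 2 = 0 then J else 1) else 0) (fun s => ∏ i, if h : z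 i ∈ box 3 L then spinAt (⟨z i, h⟩ : ↥(box 3 L)) s else 0)) J k (fun i => (fun (δ : ℝ) (v : EuclideanSpace ℝ (Fin 3)) => if v 0 + v 1 + v 2 ≤ 0 then latticeApprox δ v else -latticeApprox δ ((fun v : EuclideanSpace ℝ (Fin 3) => ((ℝ ∙ (EuclideanSpace.single 0 1 + EuclideanSpace.single 1 1 + EuclideanSpace.single 2 1 : EuclideanSpace ℝ (Fin 3)))ᗮ).reflection v) v)) δ (w i)))

/-- Plane long-range order of the twin, closed term. [folklore] -/
def LROC : ℝ → Prop := (fun J : ℝ => ∃ m : ℝ, 0 < m ∧ ∀ c : Site 3, c 0 + c 1 + c 2 = 0 → m ≤ (fun (J : ℝ) (k : ℕ) (z : Fin k → Site 3) => ⨆ L : ℕ, PairIsing.gibbsAvg (fun a b : ↥(box 3 L) => if (((∑ i, |a.1 i - b.1 i| = 1) ∧ ¬ ((a.1 0 + a.1 1 + a.1 2 = 0 ∧ b.1 0 + b.1 1 + b.1 2 = 1) ∨ (a.1 0 + a.1 1 + a.1 2 = 1 ∧ b.1 0 + b.1 1 + b.1 2 = 0))) ∨ (((a.1 0 + a.1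 1 + a.1 2 = 0 ∧ b.1 0 + b.1 1 + b.1 2 = 1) ∨ (a.1 0 + a.1 1 + a.1 2 = 1 ∧ b.1 0 + b.1 1 + b.1 2 = 0)) ∧ ∃ i : Fin 3, a.1 + b.1 = Pi.single i 1)) then (criticalBeta 3 / 2) * (if a.1 0 + a.1 1 + a.1 2 = 0 ∨ b.1 0 + b.1 1 + b.1 2 = 0 then J else 1) else 0) (fun s => ∏ i, if h : z i ∈ box 3 L then spinAt (⟨z i, h⟩ : ↥(box 3 L)) s else 0)) J 2 ![0, c])

/-- Continuous strictly positive plane-ordering threshold, closed term. [folklore] -/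
def IsSeamThresholdC : ℝ → Prop := (fun J : ℝ => 0 < J ∧ ¬ (fun J : ℝ => ∃ m : ℝ, 0 < m ∧ ∀ c : Site 3, c 0 + c 1 + c 2 = 0 → m ≤ (fun (J : ℝ) (k : ℕ) (z : Fin k → Site 3) => ⨆ L : ℕ, PairIsing.gibbsAvg (fun a b : ↥(box 3 L) => if (((∑ i, |a.1 i - b.1 i| = 1) ∧ ¬ ((a.1 0 + a.1 1 + a.1 2 = 0 ∧ b.1 0 + b.1 1 + b.1 2 = 1) ∨ (a.1 0 + a.1 1 + a.1 2 = 1 ∧ b.1 0 + b.1 1 + b.1 2 = 0))) ∨ (((a.1 0 + a.1 1 + a.1 2 = 0 ∧ b.1 0 + b.1 1 + b.1 2 = 1) ∨ (a.1 0 + a.1 1 + a.1 2 = 1 ∧ b.1 0 + b.1 1 + b.1 2 = 0)) ∧ ∃ i : Fin 3, a.1 + b.1 = Pi.single i 1)) then (criticalBeta 3 / 2) * (if a.1 0 + a.1 1 + a.1 2 = 0 ∨ b.1 0 + b.1 1 + b.1 2 = 0 then J else 1) else 0) (fun s => ∏ i, if h : z i ∈ box 3 L then spinAt (⟨z i, h⟩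 : ↥(box 3 L)) s else 0)) J 2 ![0, c]) J ∧ ∀ J' : ℝ, J < J' → (fun J : ℝ => ∃ m : ℝ, 0 < m ∧ ∀ c : Site 3, c 0 + c 1 + c 2 = 0 → m ≤ (fun (J : ℝ) (k : ℕ) (z : Fin k → Site 3) => ⨆ L : ℕ, PairIsing.gibbsAvg (fun a b : ↥(box 3 L) => if (((∑ i, |a.1 i - b.1 i| = 1) ∧ ¬ ((a.1 0 + a.1 1 + a.1 2 = 0 ∧ b.1 0 + b.1 1 + b.1 2 = 1) ∨ (a.1 0 + a.1 1 + a.1 2 = 1 ∧ b.1 0 + b.1 1 + b.1 2 = 0))) ∨ (((a.1 0 + a.1 1 + a.1 2 = 0 ∧ b.1 0 + b.1 1 + b.1 2 = 1) ∨ (a.1 0 + a.1 1 + a.1 2 = 1 ∧ b.1 0 + b.1 1 + b.1 2 = 0)) ∧ ∃ i : Fin 3, a.1 + b.1 = Pi.single i 1)) then (criticalBeta 3 / 2) * (if a.1 0 + a.1 1 + a.1 2 = 0 ∨ b.1 0 + b.1 1 + b.1 2 = 0 then J else 1) else 0) (fun s => ∏ i, if h : z i ∈ box 3 L then spinAt (⟨z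 i, h⟩ : ↥(box 3 L)) s else 0)) J 2 ![0, c]) J')

/-- Three-layer slab susceptibility `χ_T(J) ∈ [0, ∞]` of the twin, closed term. [cite: DuminilCopinICM2022, §7.1] -/
def slabChiC : ℝ → ENNReal := (fun J : ℝ => ⨆ x : {y : Site 3 // (-1 ≤ y 0 + y 1 + y 2 ∧ y 0 + y 1 + y 2 ≤ 1)}, ∑' y : {y : Site 3 // (-1 ≤ y 0 + y 1 + y 2 ∧ y 0 + y 1 + y 2 ≤ 1)}, ENNReal.ofReal ((fun (J : ℝ) (k : ℕ) (z : Fin k → Site 3) => ⨆ L : ℕ, PairIsing.gibbsAvg (fun a b : ↥(box 3 L) => if (((∑ i, |a.1 i - b.1 i| = 1) ∧ ¬ ((a.1 0 + a.1 1 + a.1 2 = 0 ∧ b.1 0 + b.1 1 + b.1 2 = 1) ∨ (a.1 0 + a.1 1 + a.1 2 = 1 ∧ b.1 0 + b.1 1 + b.1 2 = 0))) ∨ (((a.1 0 + a.1 1 + a.1 2 = 0 ∧ b.1 0 + b.1 1 + b.1 2 = 1) ∨ (a.1 0 + a.1 1 + a.1 2 = 1 ∧ b.1 0 + b.1 1 +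 b.1 2 = 0)) ∧ ∃ i : Fin 3, a.1 + b.1 = Pi.single i 1)) then (criticalBeta 3 / 2) * (if a.1 0 + a.1 1 + a.1 2 = 0 ∨ b.1 0 + b.1 1 + b.1 2 = 0 then J else 1) else 0) (fun s => ∏ i, if h : z i ∈ box 3 L then spinAt (⟨z i, h⟩ : ↥(box 3 L)) s else 0)) J 2 ![x.1, y.1]))

/-- Plane-criticality of a seam coupling: `0 < J`, `χ_T(J) = ⊤`, no plane LRO. [cite: KrishnanMetlitski2023, §1] -/
def PlaneCriticalC : ℝ → Prop := (fun J : ℝ => 0 < J ∧ (fun J : ℝ => ⨆ x : {y : Site 3 // (-1 ≤ y 0 + y 1 + y 2 ∧ y 0 + y 1 + y 2 ≤ 1)}, ∑' y : {y : Site 3 // (-1 ≤ y 0 + y 1 + y 2 ∧ y 0 + y 1 + y 2 ≤ 1)}, ENNReal.ofReal ((fun (J : ℝ) (k : ℕ) (z : Fin k → Site 3) => ⨆ L : ℕ, PairIsing.gibbsAvg (fun a b : ↥(box 3 L) => if (((∑ i, |a.1 i - b.1 i| = 1) ∧ ¬ ((a.1 0 + a.1 1 + a.1 2 = 0 ∧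 b.1 0 + b.1 1 + b.1 2 = 1) ∨ (a.1 0 + a.1 1 + a.1 2 = 1 ∧ b.1 0 + b.1 1 + b.1 2 = 0))) ∨ (((a.1 0 + a.1 1 + a.1 2 = 0 ∧ b.1 0 + b.1 1 + b.1 2 = 1) ∨ (a.1 0 + a.1 1 + a.1 2 = 1 ∧ b.1 0 + b.1 1 + b.1 2 = 0)) ∧ ∃ i : Fin 3, a.1 + b.1 = Pi.single i 1)) then (criticalBeta 3 / 2) * (if a.1 0 + a.1 1 + a.1 2 = 0 ∨ b.1 0 + b.1 1 + b.1 2 = 0 then J else 1) else 0) (fun s => ∏ i, if h : z i ∈ box 3 L then spinAt (⟨z i, h⟩ : ↥(box 3 L)) s else 0)) J 2 ![x.1, y.1])) J = ⊤ ∧ ¬ (fun J : ℝ => ∃ m : ℝ, 0 < m ∧ ∀ c : Site 3, c 0 + c 1 + c 2 = 0 → m ≤ (fun (J : ℝ) (k : ℕ) (z : Fin k → Site 3) => ⨆ L : ℕ, PairIsing.gibbsAvg (fun a b : ↥(box 3 L) => if (((∑ i, |a.1 i - b.1 i| = 1) ∧ ¬ ((a.1 0 + a.1 1 + a.1 2 =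 0 ∧ b.1 0 + b.1 1 + b.1 2 = 1) ∨ (a.1 0 + a.1 1 + a.1 2 = 1 ∧ b.1 0 + b.1 1 + b.1 2 = 0))) ∨ (((a.1 0 + a.1 1 + a.1 2 = 0 ∧ b.1 0 + b.1 1 + b.1 2 = 1) ∨ (a.1 0 + a.1 1 + a.1 2 = 1 ∧ b.1 0 + b.1 1 + b.1 2 = 0)) ∧ ∃ i : Fin 3, a.1 + b.1 = Pi.single i 1)) then (criticalBeta 3 / 2) * (if a.1 0 + a.1 1 + a.1 2 = 0 ∨ b.1 0 + b.1 1 + b.1 2 = 0 then J else 1) else 0) (fun s => ∏ i, if h : z i ∈ box 3 L then spinAt (⟨z i, h⟩ : ↥(box 3 L)) s else 0)) J 2 ![0, c]) J)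

/-- The folded replica correlator at mesh `δ`, closed term. [folklore] -/
def replicaFoldC : ℝ → (k : ℕ) → (Fin k → E) → ℝ := (fun (δ : ℝ) (k : ℕ) (w : Fin k → EuclideanSpace ℝ (Fin 3)) => Filter.limsup (fun L : ℕ => (fun (L k : ℕ) (old : Fin k → Prop) (z : Fin k → Site 3) => PairIsing.gibbsAvg (fun a b : ↥(box 3 L) => if (∑ i, |a.1 i - b.1 i| = 1) then criticalBeta 3 / 2 else (0:ℝ)) (fun s => (∏ i, if old i then (if h : z i ∈ box 3 L then spinAt (⟨z i, h⟩ : ↥(box 3 L)) s else 0) else 1) * (fun (g : SpinConfig ↥(box 3 L) → ℝ) (s : SpinConfig ↥(box 3 L)) => (∑ s' ∈ Finset.univ.filter (fun s' : SpinConfig ↥(box 3 L) => ∀ a : ↥(box 3 L), ¬ (a.1 0 + a.1 1 + a.1 2 ≤ -1) → s' a = s a), g s' * PairIsing.gibbsWeight (fun a b : ↥(box 3 L) => if (∑ i, |a.1 i - b.1 i| = 1) then criticalBeta 3 / 2 else (0:ℝ)) s') / (∑ s' ∈ Finset.univ.filter (fun s' : SpinConfig ↥(box 3 L) => ∀ a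 : ↥(box 3 L), ¬ (a.1 0 + a.1 1 + a.1 2 ≤ -1) → s' a = s a), PairIsing.gibbsWeight (fun a b : ↥(box 3 L) => if (∑ i, |a.1 i - b.1 i| = 1) then criticalBeta 3 / 2 else (0:ℝ)) s')) (fun s' => ∏ i, if old i then 1 else (if h : z i ∈ box 3 L then spinAt (⟨z i, h⟩ : ↥(box 3 L)) s' else 0)) s)) L k (fun i => w i 0 + w i 1 + w i 2 ≤ 0) (fun i => latticeApprox δ ((fun v : EuclideanSpace ℝ (Fin 3) => if v 0 + v 1 + v 2 ≤ 0 then v else (fun v : EuclideanSpace ℝ (Fin 3) => ((ℝ ∙ (EuclideanSpace.single 0 1 + EuclideanSpace.single 1 1 + EuclideanSpace.single 2 1 : EuclideanSpace ℝ (Fin 3)))ᗮ).reflection v) v) (w i)))) Filter.atTop)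

/-- **Syntactic bridge**: the crux over the named closed terms, by `Iff.rfl`. [folklore] -/
theorem twinTransparency_iff :
    Summit.CriticalPhenomena.Ising3DConformalLimit.Theses.ReflectionTwin.TwinTransparency ↔
      ∀ (ρ : ℝ → ℝ) (S : CorrFamily 3), (∀ δ ∈ Set.Ioc (0:ℝ) 1, 0 < ρ δ) →
        HasPointwiseScalingLimit (criticalCorr 3) ρ S → IsNondegenerateTwoPoint S →
        ∀ J : ℝ, IsSeamThresholdC J →
          ∃ A : E →ₗ[ℝ] E, (∀ v, v 0 + v 1 + v 2 = 0 → A v = v) ∧ (∀ v, 0 < v 0 + v 1 + v 2 → 0 < A v 0 + A v 1 + A v 2) ∧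
            ∀ k : ℕ, TendstoLocallyUniformlyOn (fun δ w => ρ δ ^ k * twinCorrC J δ k w)
              (fun w => S k (fun i => if w i 0 + w i 1 + w i 2 ≤ 0 then w i else A (w i))) (𝓝[>] (0:ℝ))
              (NonCoincident 3 k ∩ {w | ∀ i, w i 0 + w i 1 + w i 2 ≠ 0}) :=
  Iff.rfl

/-- `twinLatC J k z = ⨆ L, twinBoxC J L k z`. [folklore] -/
theorem twinLatC_eq_iSup (J : ℝ) (k : ℕ) (z : Fin k → Site 3) : twinLatC J k z = ⨆ L, twinBoxC J L k z := rfl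

/-- `twinCorrC` is `twinLatC` at the twin sites. [folklore] -/
theorem twinCorrC_eq (J δ : ℝ) (k : ℕ) (w : Fin k → E) : twinCorrC J δ k w = twinLatC J k (fun i => siteC δ (w i)) := rfl

/-- `PlaneCriticalC J ↔ 0 < J ∧ slabChiC J = ⊤ ∧ ¬ LROC J`. [folklore] -/
theorem planeCriticalC_iff (J : ℝ) : PlaneCriticalC J ↔ 0 < J ∧ slabChiC J = ⊤ ∧ ¬ LROC J := Iff.rfl

/-- `IsSeamThresholdC J ↔ 0 < J ∧ ¬ LROC J ∧ ∀ J' > J, LROC J'`. [folklore] -/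
theorem isSeamThresholdC_iff (J : ℝ) : IsSeamThresholdC J ↔ 0 < J ∧ ¬ LROC J ∧ ∀ J' : ℝ, J < J' → LROC J' := Iff.rfl

/-! ## §2 The OPEN stub statements as named propositions (byte-identical copies of the registered signatures) -/

namespace Sig

/-- Statement of `stub_responsePairing` (registered signature, verbatim). -/
def stub_responsePairing : Prop :=
    (fun (pairing : ℝ → (k : ℕ) → (Fin k → EuclideanSpace ℝ (Fin 3)) → ℝ) => ∀ (ρ : ℝ → ℝ) (S : CorrFamily 3), (∀ δ ∈ Set.Ioc (0:ℝ) 1, 0 < ρ δ) → HasPointwiseScalingLimit (criticalCorr 3) ρ S → IsNondegenerateTwoPoint S → ∀ (k : ℕ), Even k → TendstoLocallyUniformlyOn (fun (δ : ℝ) (w : Fin k → EuclideanSpace ℝ (Fin 3)) => ρ δ ^ k * pairing δ k w) (S k) (𝓝[>] (0:ℝ)) (NonCoincident 3 k ∩ {w | ∀ i, w i 0 + w i 1 + w i 2 ≠ 0} ∩ {w | (∃ i, 0 < w i 0 + w i 1 + w i 2) ∧ (∃ i, w i 0 + w i 1 + w i 2 < 0)})) (fun (δ : ℝ) (k : ℕ)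 (w : Fin k → EuclideanSpace ℝ (Fin 3)) => Filter.limsup (fun L : ℕ => (fun (L k : ℕ) (old : Fin k → Prop) (z : Fin k → Site 3) => PairIsing.gibbsAvg (fun a b : ↥(box 3 L) => if (∑ i, |a.1 i - b.1 i| = 1) then criticalBeta 3 / 2 else (0:ℝ)) (fun s => (fun (g : SpinConfig ↥(box 3 L) → ℝ) (s : SpinConfig ↥(box 3 L)) => (∑ s' ∈ Finset.univ.filter (fun s' : SpinConfig ↥(box 3 L) => ∀ a : ↥(box 3 L), ¬ (a.1 0 + a.1 1 + a.1 2 ≤ -1) → s' a = s a), g s' * PairIsing.gibbsWeight (fun a b : ↥(box 3 L) => if (∑ i, |a.1 i - b.1 i| = 1) then criticalBeta 3 / 2 else (0:ℝ)) s') / (∑ s' ∈ Finset.univ.filter (fun s' : SpinConfig ↥(box 3 L) => ∀ a : ↥(box 3 L), ¬ (a.1 0 + a.1 1 + a.1 2 ≤ -1) → s' a = s a), PairIsing.gibbsWeight (fun a b : ↥(box 3 L) => if (∑ i, |a.1 i - b.1 i| = 1) then criticalBeta 3 / 2 else (0:ℝ)) s')) (fun s' => ∏ i, if old i then (if h : z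 i ∈ box 3 L then spinAt (⟨z i, h⟩ : ↥(box 3 L)) s' else 0) else 1) s * (fun (g : SpinConfig ↥(box 3 L) → ℝ) (s : SpinConfig ↥(box 3 L)) => (∑ s' ∈ Finset.univ.filter (fun s' : SpinConfig ↥(box 3 L) => ∀ a : ↥(box 3 L), ¬ (a.1 0 + a.1 1 + a.1 2 ≤ -1) → s' a = s a), g s' * PairIsing.gibbsWeight (fun a b : ↥(box 3 L) => if (∑ i, |a.1 i - b.1 i| = 1) then criticalBeta 3 / 2 else (0:ℝ)) s') / (∑ s' ∈ Finset.univ.filter (fun s' : SpinConfig ↥(box 3 L) => ∀ a : ↥(box 3 L), ¬ (a.1 0 + a.1 1 + a.1 2 ≤ -1) → s' a = s a), PairIsing.gibbsWeight (fun a b : ↥(box 3 L) => if (∑ i, |a.1 i - b.1 i| = 1) then criticalBeta 3 / 2 else (0:ℝ)) s')) (fun s' => ∏ i, if old i then 1 else (if h : z i ∈ box 3 L then spinAt (⟨z i, h⟩ : ↥(box 3 L)) s' else 0)) s)) L k (fun i => w i 0 + w i 1 + w i 2 ≤ 0) (fun i => latticeApprox δ ((fun v : EuclideanSpace ℝ (Fin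 3) => if v 0 + v 1 + v 2 ≤ 0 then v else (fun v : EuclideanSpace ℝ (Fin 3) => ((ℝ ∙ (EuclideanSpace.single 0 1 + EuclideanSpace.single 1 1 + EuclideanSpace.single 2 1 : EuclideanSpace ℝ (Fin 3)))ᗮ).reflection v) v) (w i)))) Filter.atTop)

/-- Statement of `stub_mixedOfResponsePairing` (registered signature, verbatim). -/
def stub_mixedOfResponsePairing : Prop :=
    (fun (replicaFold : ℝ → (k : ℕ) → (Fin k → EuclideanSpace ℝ (Fin 3)) → ℝ) (pairing : ℝ → (k : ℕ) → (Fin k → EuclideanSpace ℝ (Fin 3)) → ℝ) => (∀ (ρ : ℝ → ℝ) (S : CorrFamily 3), (∀ δ ∈ Set.Ioc (0:ℝ) 1, 0 < ρ δ) → HasPointwiseScalingLimit (criticalCorr 3) ρ S → IsNondegenerateTwoPoint S → ∀ (k : ℕ), Even k → TendstoLocallyUniformlyOn (fun (δ : ℝ) (w : Fin k → EuclideanSpace ℝ (Fin 3)) => ρ δ ^ k * pairing δ k w) (S k) (𝓝[>] (0:ℝ)) (NonCoincident 3 k ∩ {w | ∀ i, w i 0 + w i 1 + w i 2 ≠ 0}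 ∩ {w | (∃ i, 0 < w i 0 + w i 1 + w i 2) ∧ (∃ i, w i 0 + w i 1 + w i 2 < 0)})) → (∀ (ρ : ℝ → ℝ) (S : CorrFamily 3), (∀ δ ∈ Set.Ioc (0:ℝ) 1, 0 < ρ δ) → HasPointwiseScalingLimit (criticalCorr 3) ρ S → IsNondegenerateTwoPoint S → ∀ (k : ℕ), Even k → TendstoLocallyUniformlyOn (fun (δ : ℝ) (w : Fin k → EuclideanSpace ℝ (Fin 3)) => ρ δ ^ k * replicaFold δ k w) (S k) (𝓝[>] (0:ℝ)) (NonCoincident 3 k ∩ {w | ∀ i, w i 0 + w i 1 + w i 2 ≠ 0} ∩ {w | (∃ i, 0 < w i 0 + w i 1 + w i 2) ∧ (∃ i, w i 0 + w i 1 + w i 2 < 0)}))) (fun (δ : ℝ) (k : ℕ) (w : Fin k → EuclideanSpace ℝ (Fin 3)) => Filter.limsup (fun L : ℕ => (fun (L k : ℕ) (old : Fin k → Prop) (z : Fin k → Site 3) => PairIsing.gibbsAvg (fun a b : ↥(box 3 L) => if (∑ i, |a.1 i - b.1 i| = 1) then criticalBeta 3 / 2 else (0:ℝ)) (fun s =>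 (∏ i, if old i then (if h : z i ∈ box 3 L then spinAt (⟨z i, h⟩ : ↥(box 3 L)) s else 0) else 1) * (fun (g : SpinConfig ↥(box 3 L) → ℝ) (s : SpinConfig ↥(box 3 L)) => (∑ s' ∈ Finset.univ.filter (fun s' : SpinConfig ↥(box 3 L) => ∀ a : ↥(box 3 L), ¬ (a.1 0 + a.1 1 + a.1 2 ≤ -1) → s' a = s a), g s' * PairIsing.gibbsWeight (fun a b : ↥(box 3 L) => if (∑ i, |a.1 i - b.1 i| = 1) then criticalBeta 3 / 2 else (0:ℝ)) s') / (∑ s' ∈ Finset.univ.filter (fun s' : SpinConfig ↥(box 3 L) => ∀ a : ↥(box 3 L), ¬ (a.1 0 + a.1 1 + a.1 2 ≤ -1) → s' a = s a), PairIsing.gibbsWeight (fun a b : ↥(box 3 L) => if (∑ i, |a.1 i - b.1 i| = 1) then criticalBeta 3 / 2 else (0:ℝ)) s')) (fun s' => ∏ i, if old i then 1 else (if h : z i ∈ box 3 L then spinAt (⟨z i, h⟩ : ↥(box 3 L)) s' else 0)) s)) L k (fun i => w i 0 + w i 1 + w i 2 ≤ 0) (fun i => latticeApprox δ ((fun v :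 EuclideanSpace ℝ (Fin 3) => if v 0 + v 1 + v 2 ≤ 0 then v else (fun v : EuclideanSpace ℝ (Fin 3) => ((ℝ ∙ (EuclideanSpace.single 0 1 + EuclideanSpace.single 1 1 + EuclideanSpace.single 2 1 : EuclideanSpace ℝ (Fin 3)))ᗮ).reflection v) v) (w i)))) Filter.atTop) (fun (δ : ℝ) (k : ℕ) (w : Fin k → EuclideanSpace ℝ (Fin 3)) => Filter.limsup (fun L : ℕ => (fun (L k : ℕ) (old : Fin k → Prop) (z : Fin k → Site 3) => PairIsing.gibbsAvg (fun a b : ↥(box 3 L) => if (∑ i, |a.1 i - b.1 i| = 1) then criticalBeta 3 / 2 else (0:ℝ)) (fun s => (fun (g : SpinConfig ↥(box 3 L) → ℝ) (s : SpinConfig ↥(box 3 L)) => (∑ s' ∈ Finset.univ.filter (fun s' : SpinConfig ↥(box 3 L) => ∀ a : ↥(box 3 L), ¬ (a.1 0 + a.1 1 + a.1 2 ≤ -1) → s' a = s a), g s' * PairIsing.gibbsWeight (fun a b : ↥(box 3 L) => if (∑ i, |a.1 i - b.1 i| = 1) then criticalBeta 3 / 2 else (0:ℝ)) s') / (∑ s'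 ∈ Finset.univ.filter (fun s' : SpinConfig ↥(box 3 L) => ∀ a : ↥(box 3 L), ¬ (a.1 0 + a.1 1 + a.1 2 ≤ -1) → s' a = s a), PairIsing.gibbsWeight (fun a b : ↥(box 3 L) => if (∑ i, |a.1 i - b.1 i| = 1) then criticalBeta 3 / 2 else (0:ℝ)) s')) (fun s' => ∏ i, if old i then (if h : z i ∈ box 3 L then spinAt (⟨z i, h⟩ : ↥(box 3 L)) s' else 0) else 1) s * (fun (g : SpinConfig ↥(box 3 L) → ℝ) (s : SpinConfig ↥(box 3 L)) => (∑ s' ∈ Finset.univ.filter (fun s' : SpinConfig ↥(box 3 L) => ∀ a : ↥(box 3 L), ¬ (a.1 0 + a.1 1 + a.1 2 ≤ -1) → s' a = s a), g s' * PairIsing.gibbsWeight (fun a b : ↥(box 3 L) => if (∑ i, |a.1 i - b.1 i| = 1) then criticalBeta 3 / 2 else (0:ℝ)) s') / (∑ s' ∈ Finset.univ.filter (fun s' : SpinConfig ↥(box 3 L) => ∀ a : ↥(box 3 L), ¬ (a.1 0 + a.1 1 + a.1 2 ≤ -1) → s' a = s a), PairIsing.gibbsWeight (fun a b : ↥(box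 3 L) => if (∑ i, |a.1 i - b.1 i| = 1) then criticalBeta 3 / 2 else (0:ℝ)) s')) (fun s' => ∏ i, if old i then 1 else (if h : z i ∈ box 3 L then spinAt (⟨z i, h⟩ : ↥(box 3 L)) s' else 0)) s)) L k (fun i => w i 0 + w i 1 + w i 2 ≤ 0) (fun i => latticeApprox δ ((fun v : EuclideanSpace ℝ (Fin 3) => if v 0 + v 1 + v 2 ≤ 0 then v else (fun v : EuclideanSpace ℝ (Fin 3) => ((ℝ ∙ (EuclideanSpace.single 0 1 + EuclideanSpace.single 1 1 + EuclideanSpace.single 2 1 : EuclideanSpace ℝ (Fin 3)))ᗮ).reflection v) v) (w i)))) Filter.atTop)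

/-- Statement of `stub_twinIsReplicaEvenUniform` (registered signature, verbatim). -/
def stub_twinIsReplicaEvenUniform : Prop :=
    (fun (twinCorr : ℝ → ℝ → (k : ℕ) → (Fin k → EuclideanSpace ℝ (Fin 3)) → ℝ) (replicaFold : ℝ → (k : ℕ) → (Fin k → EuclideanSpace ℝ (Fin 3)) → ℝ) (PlaneCritical : ℝ → Prop) => ∀ (ρ : ℝ → ℝ) (S : CorrFamily 3), (∀ δ ∈ Set.Ioc (0:ℝ) 1, 0 < ρ δ) → HasPointwiseScalingLimit (criticalCorr 3) ρ S → IsNondegenerateTwoPoint S → ∀ J : ℝ, PlaneCritical J → ∀ (k : ℕ), Even k → k ≠ 0 → TendstoLocallyUniformlyOn (fun (δ : ℝ) (w : Fin k → EuclideanSpace ℝ (Fin 3)) => ρ δ ^ k * twinCorr J δ k w - ρ δ ^ k * replicaFold δ k w) (fun _ => (0:ℝ)) (𝓝[>] (0:ℝ)) (NonCoincident 3 k ∩ {w | ∀ i, w i 0 + w i 1 + w i 2 ≠ 0})) (fun (J δ : ℝ) (k : ℕ) (w : Fin k → EuclideanSpace ℝ (Fin 3)) => (fun (J : ℝ) (k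 : ℕ) (z : Fin k → Site 3) => ⨆ L : ℕ, PairIsing.gibbsAvg (fun a b : ↥(box 3 L) => if (((∑ i, |a.1 i - b.1 i| = 1) ∧ ¬ ((a.1 0 + a.1 1 + a.1 2 = 0 ∧ b.1 0 + b.1 1 + b.1 2 = 1) ∨ (a.1 0 + a.1 1 + a.1 2 = 1 ∧ b.1 0 + b.1 1 + b.1 2 = 0))) ∨ (((a.1 0 + a.1 1 + a.1 2 = 0 ∧ b.1 0 + b.1 1 + b.1 2 = 1) ∨ (a.1 0 + a.1 1 + a.1 2 = 1 ∧ b.1 0 + b.1 1 + b.1 2 = 0)) ∧ ∃ i : Fin 3, a.1 + b.1 = Pi.single i 1)) then (criticalBeta 3 / 2) * (if a.1 0 + a.1 1 + a.1 2 = 0 ∨ b.1 0 + b.1 1 + b.1 2 = 0 then J else 1) else 0) (fun s => ∏ i, if h : z i ∈ box 3 L then spinAt (⟨z i, h⟩ : ↥(box 3 L)) s else 0)) J k (fun i => (fun (δ : ℝ) (v : EuclideanSpace ℝ (Fin 3)) => if v 0 + v 1 + v 2 ≤ 0 then latticeApprox δ v else -latticeApprox δ ((fun v : EuclideanSpace ℝ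 (Fin 3) => ((ℝ ∙ (EuclideanSpace.single 0 1 + EuclideanSpace.single 1 1 + EuclideanSpace.single 2 1 : EuclideanSpace ℝ (Fin 3)))ᗮ).reflection v) v)) δ (w i))) (fun (δ : ℝ) (k : ℕ) (w : Fin k → EuclideanSpace ℝ (Fin 3)) => Filter.limsup (fun L : ℕ => (fun (L k : ℕ) (old : Fin k → Prop) (z : Fin k → Site 3) => PairIsing.gibbsAvg (fun a b : ↥(box 3 L) => if (∑ i, |a.1 i - b.1 i| = 1) then criticalBeta 3 / 2 else (0:ℝ)) (fun s => (∏ i, if old i then (if h : z i ∈ box 3 L then spinAt (⟨z i, h⟩ : ↥(box 3 L)) s else 0) else 1) * (fun (g : SpinConfig ↥(box 3 L) → ℝ) (s : SpinConfig ↥(box 3 L)) => (∑ s' ∈ Finset.univ.filter (fun s' : SpinConfig ↥(box 3 L) => ∀ a : ↥(box 3 L), ¬ (a.1 0 + a.1 1 + a.1 2 ≤ -1) → s' a = s a), g s' * PairIsing.gibbsWeight (fun a b : ↥(box 3 L) => if (∑ i, |a.1 i - b.1 i| = 1) then criticalBeta 3 / 2 else (0:ℝ)) s') / (∑ s' ∈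 Finset.univ.filter (fun s' : SpinConfig ↥(box 3 L) => ∀ a : ↥(box 3 L), ¬ (a.1 0 + a.1 1 + a.1 2 ≤ -1) → s' a = s a), PairIsing.gibbsWeight (fun a b : ↥(box 3 L) => if (∑ i, |a.1 i - b.1 i| = 1) then criticalBeta 3 / 2 else (0:ℝ)) s')) (fun s' => ∏ i, if old i then 1 else (if h : z i ∈ box 3 L then spinAt (⟨z i, h⟩ : ↥(box 3 L)) s' else 0)) s)) L k (fun i => w i 0 + w i 1 + w i 2 ≤ 0) (fun i => latticeApprox δ ((fun v : EuclideanSpace ℝ (Fin 3) => if v 0 + v 1 + v 2 ≤ 0 then v else (fun v : EuclideanSpace ℝ (Fin 3) => ((ℝ ∙ (EuclideanSpace.single 0 1 + EuclideanSpace.single 1 1 + EuclideanSpace.single 2 1 : EuclideanSpace ℝ (Fin 3)))ᗮ).reflection v) v) (w i)))) Filter.atTop) (fun J : ℝ => 0 < J ∧ (fun J : ℝ => ⨆ x : {y : Site 3 // (-1 ≤ y 0 + y 1 + y 2 ∧ y 0 + y 1 + y 2 ≤ 1)}, ∑' y : {y : Site 3 // (-1 ≤ y 0 + y 1 + y 2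 ∧ y 0 + y 1 + y 2 ≤ 1)}, ENNReal.ofReal ((fun (J : ℝ) (k : ℕ) (z : Fin k → Site 3) => ⨆ L : ℕ, PairIsing.gibbsAvg (fun a b : ↥(box 3 L) => if (((∑ i, |a.1 i - b.1 i| = 1) ∧ ¬ ((a.1 0 + a.1 1 + a.1 2 = 0 ∧ b.1 0 + b.1 1 + b.1 2 = 1) ∨ (a.1 0 + a.1 1 + a.1 2 = 1 ∧ b.1 0 + b.1 1 + b.1 2 = 0))) ∨ (((a.1 0 + a.1 1 + a.1 2 = 0 ∧ b.1 0 + b.1 1 + b.1 2 = 1) ∨ (a.1 0 + a.1 1 + a.1 2 = 1 ∧ b.1 0 + b.1 1 + b.1 2 = 0)) ∧ ∃ i : Fin 3, a.1 + b.1 = Pi.single i 1)) then (criticalBeta 3 / 2) * (if a.1 0 + a.1 1 + a.1 2 = 0 ∨ b.1 0 + b.1 1 + b.1 2 = 0 then J else 1) else 0) (fun s => ∏ i, if h : z i ∈ box 3 L then spinAt (⟨z i, h⟩ : ↥(box 3 L)) s else 0)) J 2 ![x.1, y.1])) J = ⊤ ∧ ¬ (fun J : ℝ => ∃ m : ℝ,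 0 < m ∧ ∀ c : Site 3, c 0 + c 1 + c 2 = 0 → m ≤ (fun (J : ℝ) (k : ℕ) (z : Fin k → Site 3) => ⨆ L : ℕ, PairIsing.gibbsAvg (fun a b : ↥(box 3 L) => if (((∑ i, |a.1 i - b.1 i| = 1) ∧ ¬ ((a.1 0 + a.1 1 + a.1 2 = 0 ∧ b.1 0 + b.1 1 + b.1 2 = 1) ∨ (a.1 0 + a.1 1 + a.1 2 = 1 ∧ b.1 0 + b.1 1 + b.1 2 = 0))) ∨ (((a.1 0 + a.1 1 + a.1 2 = 0 ∧ b.1 0 + b.1 1 + b.1 2 = 1) ∨ (a.1 0 + a.1 1 + a.1 2 = 1 ∧ b.1 0 + b.1 1 + b.1 2 = 0)) ∧ ∃ i : Fin 3, a.1 + b.1 = Pi.single i 1)) then (criticalBeta 3 / 2) * (if a.1 0 + a.1 1 + a.1 2 = 0 ∨ b.1 0 + b.1 1 + b.1 2 = 0 then J else 1) else 0) (fun s => ∏ i, if h : z i ∈ box 3 L then spinAt (⟨z i, h⟩ : ↥(box 3 L)) s else 0)) J 2 ![0, c]) J)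

end Sig

/-! ## §3 Landed stubs (imported; checked against their registered signatures) and the OPEN stubs (the only `sorry`s) -/

-- stub_twinBoxMonotone: LANDED (p166827), `Summits.CriticalPhenomena.Ising3DConformalLimit.Theorems.ReflectionTwinTwinTransparencyTwinBoxMonotone`
example :
    (fun (twinBox : ℝ → ℕ → (k : ℕ) → (Fin k → Site 3) → ℝ) => (∀ (J : ℝ) (k : ℕ) (z : Fin k → Site 3) (L L' : ℕ), 0 ≤ J → L ≤ L' → twinBox J L k z ≤ twinBox J L' k z) ∧ (∀ (J J' : ℝ) (k : ℕ) (z : Fin k → Site 3) (L : ℕ), 0 ≤ J → J ≤ J' → twinBox J L k z ≤ twinBox J' L k z) ∧ (∀ (J : ℝ) (k : ℕ) (z : Fin k → Site 3) (L : ℕ), |twinBox J L k z| ≤ 1)) (fun (J : ℝ) (L : ℕ) (k : ℕ) (z : Fin k → Site 3) => PairIsing.gibbsAvg (fun a b : ↥(box 3 L) => if (((∑ i, |a.1 i - b.1 i| = 1) ∧ ¬ ((a.1 0 + a.1 1 + a.1 2 = 0 ∧ b.1 0 + b.1 1 + b.1 2 = 1) ∨ (a.1 0 + a.1 1 + a.1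 2 = 1 ∧ b.1 0 + b.1 1 + b.1 2 = 0))) ∨ (((a.1 0 + a.1 1 + a.1 2 = 0 ∧ b.1 0 + b.1 1 + b.1 2 = 1) ∨ (a.1 0 + a.1 1 + a.1 2 = 1 ∧ b.1 0 + b.1 1 + b.1 2 = 0)) ∧ ∃ i : Fin 3, a.1 + b.1 = Pi.single i 1)) then (criticalBeta 3 / 2) * (if a.1 0 + a.1 1 + a.1 2 = 0 ∨ b.1 0 + b.1 1 + b.1 2 = 0 then J else 1) else 0) (fun s => ∏ i, if h : z i ∈ box 3 L then spinAt (⟨z i, h⟩ : ↥(box 3 L)) s else 0)) :=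
  stub_twinBoxMonotone

-- stub_seamLebowitzIncrement: LANDED (p169671), `Summits.CriticalPhenomena.Ising3DConformalLimit.Theorems.ReflectionTwinTwinTransparencySeamLebowitzIncrement`
example :
    (fun (slabSum : ℝ → (L : ℕ) → ↥(box 3 L) → ℝ) => ∀ (L : ℕ) (J₁ J₂ M : ℝ), 0 ≤ J₁ → J₁ ≤ J₂ → (∀ a : ↥(box 3 L), (-1 ≤ a.1 0 + a.1 1 + a.1 2 ∧ a.1 0 + a.1 1 + a.1 2 ≤ 1) → slabSum J₂ L a ≤ M) → ∀ a : ↥(box 3 L), (-1 ≤ a.1 0 + a.1 1 + a.1 2 ∧ a.1 0 + a.1 1 + a.1 2 ≤ 1) → slabSum J₂ L a - slabSum J₁ L a ≤ 12 * criticalBeta 3 * (J₂ - J₁) * M ^ 2) (fun (J : ℝ) (L : ℕ) (a : ↥(box 3 L)) => ∑ b : ↥(box 3 L), if (-1 ≤ b.1 0 + b.1 1 + b.1 2 ∧ b.1 0 + b.1 1 + b.1 2 ≤ 1) then PairIsing.gibbsAvg (fun a b : ↥(box 3 L) => if (((∑ i, |a.1 i - b.1 i| = 1) ∧ ¬ ((a.1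 0 + a.1 1 + a.1 2 = 0 ∧ b.1 0 + b.1 1 + b.1 2 = 1) ∨ (a.1 0 + a.1 1 + a.1 2 = 1 ∧ b.1 0 + b.1 1 + b.1 2 = 0))) ∨ (((a.1 0 + a.1 1 + a.1 2 = 0 ∧ b.1 0 + b.1 1 + b.1 2 = 1) ∨ (a.1 0 + a.1 1 + a.1 2 = 1 ∧ b.1 0 + b.1 1 + b.1 2 = 0)) ∧ ∃ i : Fin 3, a.1 + b.1 = Pi.single i 1)) then (criticalBeta 3 / 2) * (if a.1 0 + a.1 1 + a.1 2 = 0 ∨ b.1 0 + b.1 1 + b.1 2 = 0 then J else 1) else 0) (fun s => spinAt a s * spinAt b s) else 0) :=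
  stub_seamLebowitzIncrement

-- stub_thresholdNotCut: LANDED (p170398), `Summits.CriticalPhenomena.Ising3DConformalLimit.Theorems.ReflectionTwinTwinTransparencyThresholdNotCut`
example :
    (fun (IsSeamThreshold : ℝ → Prop) (slabChi : ℝ → ENNReal) => ((fun (twinBox : ℝ → ℕ → (k : ℕ) → (Fin k → Site 3) → ℝ) => (∀ (J : ℝ) (k : ℕ) (z : Fin k → Site 3) (L L' : ℕ), 0 ≤ J → L ≤ L' → twinBox J L k z ≤ twinBox J L' k z) ∧ (∀ (J J' : ℝ) (k : ℕ) (z : Fin k → Site 3) (L : ℕ), 0 ≤ J → J ≤ J' → twinBox J L k z ≤ twinBox J' L k z) ∧ (∀ (J : ℝ) (k : ℕ) (z : Fin k → Site 3) (L : ℕ), |twinBox J L k z| ≤ 1)) (fun (J : ℝ) (L : ℕ) (k : ℕ) (z : Fin k → Site 3) => PairIsing.gibbsAvg (fun a b : ↥(box 3 L) => if (((∑ i, |a.1 i - b.1 i| = 1) ∧ ¬ ((a.1 0 + a.1 1 + a.1 2 = 0 ∧ b.1 0 + b.1 1 + b.1 2 = 1) ∨ (a.1 0 + a.1 1 + a.1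 2 = 1 ∧ b.1 0 + b.1 1 + b.1 2 = 0))) ∨ (((a.1 0 + a.1 1 + a.1 2 = 0 ∧ b.1 0 + b.1 1 + b.1 2 = 1) ∨ (a.1 0 + a.1 1 + a.1 2 = 1 ∧ b.1 0 + b.1 1 + b.1 2 = 0)) ∧ ∃ i : Fin 3, a.1 + b.1 = Pi.single i 1)) then (criticalBeta 3 / 2) * (if a.1 0 + a.1 1 + a.1 2 = 0 ∨ b.1 0 + b.1 1 + b.1 2 = 0 then J else 1) else 0) (fun s => ∏ i, if h : z i ∈ box 3 L then spinAt (⟨z i, h⟩ : ↥(box 3 L)) s else 0))) → ((fun (slabSum : ℝ → (L : ℕ) → ↥(box 3 L) → ℝ) => ∀ (L : ℕ) (J₁ J₂ M : ℝ), 0 ≤ J₁ → J₁ ≤ J₂ → (∀ a : ↥(box 3 L), (-1 ≤ a.1 0 + a.1 1 + a.1 2 ∧ a.1 0 + a.1 1 + a.1 2 ≤ 1) → slabSum J₂ L a ≤ M) → ∀ a : ↥(box 3 L), (-1 ≤ a.1 0 + a.1 1 + a.1 2 ∧ a.1 0 + a.1 1 + a.1 2 ≤ 1) → slabSum J₂ L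 a - slabSum J₁ L a ≤ 12 * criticalBeta 3 * (J₂ - J₁) * M ^ 2) (fun (J : ℝ) (L : ℕ) (a : ↥(box 3 L)) => ∑ b : ↥(box 3 L), if (-1 ≤ b.1 0 + b.1 1 + b.1 2 ∧ b.1 0 + b.1 1 + b.1 2 ≤ 1) then PairIsing.gibbsAvg (fun a b : ↥(box 3 L) => if (((∑ i, |a.1 i - b.1 i| = 1) ∧ ¬ ((a.1 0 + a.1 1 + a.1 2 = 0 ∧ b.1 0 + b.1 1 + b.1 2 = 1) ∨ (a.1 0 + a.1 1 + a.1 2 = 1 ∧ b.1 0 + b.1 1 + b.1 2 = 0))) ∨ (((a.1 0 + a.1 1 + a.1 2 = 0 ∧ b.1 0 + b.1 1 + b.1 2 = 1) ∨ (a.1 0 + a.1 1 + a.1 2 = 1 ∧ b.1 0 + b.1 1 + b.1 2 = 0)) ∧ ∃ i : Fin 3, a.1 + b.1 = Pi.single i 1)) then (criticalBeta 3 / 2) * (if a.1 0 + a.1 1 + a.1 2 = 0 ∨ b.1 0 + b.1 1 + b.1 2 = 0 then J else 1) else 0) (fun s => spinAt a s * spinAt b s) else 0)) → ∀ J : ℝ,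 IsSeamThreshold J → slabChi J = ⊤) (fun J : ℝ => 0 < J ∧ ¬ (fun J : ℝ => ∃ m : ℝ, 0 < m ∧ ∀ c : Site 3, c 0 + c 1 + c 2 = 0 → m ≤ (fun (J : ℝ) (k : ℕ) (z : Fin k → Site 3) => ⨆ L : ℕ, PairIsing.gibbsAvg (fun a b : ↥(box 3 L) => if (((∑ i, |a.1 i - b.1 i| = 1) ∧ ¬ ((a.1 0 + a.1 1 + a.1 2 = 0 ∧ b.1 0 + b.1 1 + b.1 2 = 1) ∨ (a.1 0 + a.1 1 + a.1 2 = 1 ∧ b.1 0 + b.1 1 + b.1 2 = 0))) ∨ (((a.1 0 + a.1 1 + a.1 2 = 0 ∧ b.1 0 + b.1 1 + b.1 2 = 1) ∨ (a.1 0 + a.1 1 + a.1 2 = 1 ∧ b.1 0 + b.1 1 + b.1 2 = 0)) ∧ ∃ i : Fin 3, a.1 + b.1 = Pi.single i 1)) then (criticalBeta 3 / 2) * (if a.1 0 + a.1 1 + a.1 2 = 0 ∨ b.1 0 + b.1 1 + b.1 2 = 0 then J else 1) else 0) (fun s => ∏ i, if h : z i ∈ box 3 L then spinAt (⟨z i,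 h⟩ : ↥(box 3 L)) s else 0)) J 2 ![0, c]) J ∧ ∀ J' : ℝ, J < J' → (fun J : ℝ => ∃ m : ℝ, 0 < m ∧ ∀ c : Site 3, c 0 + c 1 + c 2 = 0 → m ≤ (fun (J : ℝ) (k : ℕ) (z : Fin k → Site 3) => ⨆ L : ℕ, PairIsing.gibbsAvg (fun a b : ↥(box 3 L) => if (((∑ i, |a.1 i - b.1 i| = 1) ∧ ¬ ((a.1 0 + a.1 1 + a.1 2 = 0 ∧ b.1 0 + b.1 1 + b.1 2 = 1) ∨ (a.1 0 + a.1 1 + a.1 2 = 1 ∧ b.1 0 + b.1 1 + b.1 2 = 0))) ∨ (((a.1 0 + a.1 1 + a.1 2 = 0 ∧ b.1 0 + b.1 1 + b.1 2 = 1) ∨ (a.1 0 + a.1 1 + a.1 2 = 1 ∧ b.1 0 + b.1 1 + b.1 2 = 0)) ∧ ∃ i : Fin 3, a.1 + b.1 = Pi.single i 1)) then (criticalBeta 3 / 2) * (if a.1 0 + a.1 1 + a.1 2 = 0 ∨ b.1 0 + b.1 1 + b.1 2 = 0 then J else 1) else 0) (fun s => ∏ i, if h : z i ∈ box 3 L then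 spinAt (⟨z i, h⟩ : ↥(box 3 L)) s else 0)) J 2 ![0, c]) J') (fun J : ℝ => ⨆ x : {y : Site 3 // (-1 ≤ y 0 + y 1 + y 2 ∧ y 0 + y 1 + y 2 ≤ 1)}, ∑' y : {y : Site 3 // (-1 ≤ y 0 + y 1 + y 2 ∧ y 0 + y 1 + y 2 ≤ 1)}, ENNReal.ofReal ((fun (J : ℝ) (k : ℕ) (z : Fin k → Site 3) => ⨆ L : ℕ, PairIsing.gibbsAvg (fun a b : ↥(box 3 L) => if (((∑ i, |a.1 i - b.1 i| = 1) ∧ ¬ ((a.1 0 + a.1 1 + a.1 2 = 0 ∧ b.1 0 + b.1 1 + b.1 2 = 1) ∨ (a.1 0 + a.1 1 + a.1 2 = 1 ∧ b.1 0 + b.1 1 + b.1 2 = 0))) ∨ (((a.1 0 + a.1 1 + a.1 2 = 0 ∧ b.1 0 + b.1 1 + b.1 2 = 1) ∨ (a.1 0 + a.1 1 + a.1 2 = 1 ∧ b.1 0 + b.1 1 + b.1 2 = 0)) ∧ ∃ i : Fin 3, a.1 + b.1 = Pi.single i 1)) then (criticalBeta 3 / 2) * (if a.1 0 + a.1 1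 + a.1 2 = 0 ∨ b.1 0 + b.1 1 + b.1 2 = 0 then J else 1) else 0) (fun s => ∏ i, if h : z i ∈ box 3 L then spinAt (⟨z i, h⟩ : ↥(box 3 L)) s else 0)) J 2 ![x.1, y.1])) :=
  stub_thresholdNotCut

-- stub_replicaLower: LANDED (p170708), `Summits.CriticalPhenomena.Ising3DConformalLimit.Theorems.ReflectionTwinTwinTransparencyReplicaLower`
example :
    (fun (replicaFold : ℝ → (k : ℕ) → (Fin k → EuclideanSpace ℝ (Fin 3)) → ℝ) => ∀ (ρ : ℝ → ℝ) (S : CorrFamily 3), HasPointwiseScalingLimit (criticalCorr 3) ρ S → ∀ (k : ℕ), ∀ w ∈ NonCoincident 3 k, (∀ i, w i 0 + w i 1 + w i 2 < 0) → Filter.Tendsto (fun δ : ℝ => ρ δ ^ k * replicaFold δ k w) (𝓝[>] (0:ℝ)) (𝓝 (S k w))) (fun (δ : ℝ) (k : ℕ) (w : Fin k → EuclideanSpace ℝ (Fin 3)) => Filter.limsup (fun L : ℕ => (fun (L k : ℕ) (old : Fin k → Prop) (z : Fin k → Site 3) => PairIsing.gibbsAvg (fun a b : ↥(box 3 L) =>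 if (∑ i, |a.1 i - b.1 i| = 1) then criticalBeta 3 / 2 else (0:ℝ)) (fun s => (∏ i, if old i then (if h : z i ∈ box 3 L then spinAt (⟨z i, h⟩ : ↥(box 3 L)) s else 0) else 1) * (fun (g : SpinConfig ↥(box 3 L) → ℝ) (s : SpinConfig ↥(box 3 L)) => (∑ s' ∈ Finset.univ.filter (fun s' : SpinConfig ↥(box 3 L) => ∀ a : ↥(box 3 L), ¬ (a.1 0 + a.1 1 + a.1 2 ≤ -1) → s' a = s a), g s' * PairIsing.gibbsWeight (fun a b : ↥(box 3 L) => if (∑ i, |a.1 i - b.1 i| = 1) then criticalBeta 3 / 2 else (0:ℝ)) s') / (∑ s' ∈ Finset.univ.filter (fun s' : SpinConfig ↥(box 3 L) => ∀ a : ↥(box 3 L), ¬ (a.1 0 + a.1 1 + a.1 2 ≤ -1) → s' a = s a), PairIsing.gibbsWeight (fun a b : ↥(box 3 L) => if (∑ i, |a.1 i - b.1 i| = 1) then criticalBeta 3 / 2 else (0:ℝ)) s')) (fun s' => ∏ i, if old i then 1 else (if h : z i ∈ box 3 L then spinAt (⟨z i, h⟩ : ↥(box 3 L)) s' else 0)) s))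 L k (fun i => w i 0 + w i 1 + w i 2 ≤ 0) (fun i => latticeApprox δ ((fun v : EuclideanSpace ℝ (Fin 3) => if v 0 + v 1 + v 2 ≤ 0 then v else (fun v : EuclideanSpace ℝ (Fin 3) => ((ℝ ∙ (EuclideanSpace.single 0 1 + EuclideanSpace.single 1 1 + EuclideanSpace.single 2 1 : EuclideanSpace ℝ (Fin 3)))ᗮ).reflection v) v) (w i)))) Filter.atTop) :=
  stub_replicaLower

-- stub_replicaAllUpper: LANDED (p170823), `Summits.CriticalPhenomena.Ising3DConformalLimit.Theorems.ReflectionTwinTwinTransparencyReplicaAllUpper`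
example :
    (fun (replicaFold : ℝ → (k : ℕ) → (Fin k → EuclideanSpace ℝ (Fin 3)) → ℝ) => ∀ (ρ : ℝ → ℝ) (S : CorrFamily 3), (∀ δ ∈ Set.Ioc (0:ℝ) 1, 0 < ρ δ) → HasPointwiseScalingLimit (criticalCorr 3) ρ S → IsNondegenerateTwoPoint S → ∀ (k : ℕ), ∀ w ∈ NonCoincident 3 k, (∀ i, 0 < w i 0 + w i 1 + w i 2) → Filter.Tendsto (fun δ : ℝ => ρ δ ^ k * replicaFold δ k w) (𝓝[>] (0:ℝ)) (𝓝 (S k w))) (fun (δ : ℝ) (k : ℕ) (w : Fin k → EuclideanSpace ℝ (Fin 3)) => Filter.limsup (fun L : ℕ => (fun (L k : ℕ) (old : Fin k → Prop) (z : Fin k → Site 3) => PairIsing.gibbsAvg (fun a b : ↥(box 3 L) => if (∑ i, |a.1 i - b.1 i| = 1) then criticalBeta 3 / 2 else (0:ℝ)) (fun s => (∏ i, if old i then (if h : z i ∈ box 3 L then spinAt (⟨z i, h⟩ : ↥(box 3 L)) s else 0) else 1) * (fun (g : SpinConfig ↥(box 3 L) → ℝ) (s : SpinConfig ↥(box 3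 L)) => (∑ s' ∈ Finset.univ.filter (fun s' : SpinConfig ↥(box 3 L) => ∀ a : ↥(box 3 L), ¬ (a.1 0 + a.1 1 + a.1 2 ≤ -1) → s' a = s a), g s' * PairIsing.gibbsWeight (fun a b : ↥(box 3 L) => if (∑ i, |a.1 i - b.1 i| = 1) then criticalBeta 3 / 2 else (0:ℝ)) s') / (∑ s' ∈ Finset.univ.filter (fun s' : SpinConfig ↥(box 3 L) => ∀ a : ↥(box 3 L), ¬ (a.1 0 + a.1 1 + a.1 2 ≤ -1) → s' a = s a), PairIsing.gibbsWeight (fun a b : ↥(box 3 L) => if (∑ i, |a.1 i - b.1 i| = 1) then criticalBeta 3 / 2 else (0:ℝ)) s')) (fun s' => ∏ i, if old i then 1 else (if h : z i ∈ box 3 L then spinAt (⟨z i, h⟩ : ↥(box 3 L)) s' else 0)) s)) L k (fun i => w i 0 + w i 1 + w i 2 ≤ 0) (fun i => latticeApprox δ ((fun v : EuclideanSpace ℝ (Fin 3) => if v 0 + v 1 + v 2 ≤ 0 then v else (fun v : EuclideanSpace ℝ (Fin 3) => ((ℝ ∙ (EuclideanSpace.single 0 1 + EuclideanSpace.single 1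 1 + EuclideanSpace.single 2 1 : EuclideanSpace ℝ (Fin 3)))ᗮ).reflection v) v) (w i)))) Filter.atTop) :=
  stub_replicaAllUpper


-- stub_replicaLowerUniform: LANDED (p172237), `Summits.CriticalPhenomena.Ising3DConformalLimit.Theorems.ReflectionTwinTwinTransparencyReplicaLowerUniform`
example :
    (fun (replicaFold : ℝ → (k : ℕ) → (Fin k → EuclideanSpace ℝ (Fin 3)) → ℝ) => ∀ (ρ : ℝ → ℝ) (S : CorrFamily 3), HasPointwiseScalingLimit (criticalCorr 3) ρ S → ∀ (k : ℕ), TendstoLocallyUniformlyOn (fun (δ : ℝ) (w : Fin k → EuclideanSpace ℝ (Fin 3)) => ρ δ ^ k * replicaFold δ k w) (S k) (𝓝[>] (0:ℝ)) (NonCoincident 3 k ∩ {w | ∀ i, w i 0 + w i 1 + w i 2 < 0})) (fun (δ : ℝ) (k : ℕ) (w : Fin k → EuclideanSpace ℝ (Fin 3)) => Filter.limsup (fun L : ℕ => (fun (L k : ℕ) (old : Fin k → Prop) (z : Fin k → Site 3) => PairIsing.gibbsAvg (fun a b : ↥(box 3 L) => if (∑ i, |a.1 i - b.1 i| = 1)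 then criticalBeta 3 / 2 else (0:ℝ)) (fun s => (∏ i, if old i then (if h : z i ∈ box 3 L then spinAt (⟨z i, h⟩ : ↥(box 3 L)) s else 0) else 1) * (fun (g : SpinConfig ↥(box 3 L) → ℝ) (s : SpinConfig ↥(box 3 L)) => (∑ s' ∈ Finset.univ.filter (fun s' : SpinConfig ↥(box 3 L) => ∀ a : ↥(box 3 L), ¬ (a.1 0 + a.1 1 + a.1 2 ≤ -1) → s' a = s a), g s' * PairIsing.gibbsWeight (fun a b : ↥(box 3 L) => if (∑ i, |a.1 i - b.1 i| = 1) then criticalBeta 3 / 2 else (0:ℝ)) s') / (∑ s' ∈ Finset.univ.filter (fun s' : SpinConfig ↥(box 3 L) => ∀ a : ↥(box 3 L), ¬ (a.1 0 + a.1 1 + a.1 2 ≤ -1) → s' a = s a), PairIsing.gibbsWeight (fun a b : ↥(box 3 L) => if (∑ i, |a.1 i - b.1 i| = 1) then criticalBeta 3 / 2 else (0:ℝ)) s')) (fun s' => ∏ i, if old i then 1 else (if h : z i ∈ box 3 L then spinAt (⟨z i, h⟩ : ↥(box 3 L)) s' else 0)) s)) L k (fun i => w i 0 + w i 1 + w i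 2 ≤ 0) (fun i => latticeApprox δ ((fun v : EuclideanSpace ℝ (Fin 3) => if v 0 + v 1 + v 2 ≤ 0 then v else (fun v : EuclideanSpace ℝ (Fin 3) => ((ℝ ∙ (EuclideanSpace.single 0 1 + EuclideanSpace.single 1 1 + EuclideanSpace.single 2 1 : EuclideanSpace ℝ (Fin 3)))ᗮ).reflection v) v) (w i)))) Filter.atTop) :=
  stub_replicaLowerUniform

-- stub_replicaAllUpperUniform: LANDED (p172410), `Summits.CriticalPhenomena.Ising3DConformalLimit.Theorems.ReflectionTwinTwinTransparencyReplicaAllUpperUniform`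
example :
    (fun (replicaFold : ℝ → (k : ℕ) → (Fin k → EuclideanSpace ℝ (Fin 3)) → ℝ) => ∀ (ρ : ℝ → ℝ) (S : CorrFamily 3), (∀ δ ∈ Set.Ioc (0:ℝ) 1, 0 < ρ δ) → HasPointwiseScalingLimit (criticalCorr 3) ρ S → IsNondegenerateTwoPoint S → ∀ (k : ℕ), TendstoLocallyUniformlyOn (fun (δ : ℝ) (w : Fin k → EuclideanSpace ℝ (Fin 3)) => ρ δ ^ k * replicaFold δ k w) (S k) (𝓝[>] (0:ℝ)) (NonCoincident 3 k ∩ {w | ∀ i, 0 < w i 0 + w i 1 + w i 2})) (fun (δ : ℝ) (k : ℕ) (w : Fin k → EuclideanSpace ℝ (Fin 3)) => Filter.limsup (fun L : ℕ => (fun (L k : ℕ) (old : Fin k → Prop) (z : Fin k → Site 3) => PairIsing.gibbsAvg (fun a b : ↥(box 3 L) => if (∑ i, |a.1 i - b.1 i| = 1) then criticalBeta 3 / 2 else (0:ℝ)) (fun s => (∏ i, if old i then (if h : z i ∈ box 3 L then spinAt (⟨z i, h⟩ : ↥(box 3 L)) s else 0) else 1) * (fun (g : SpinConfig ↥(box 3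 L) → ℝ) (s : SpinConfig ↥(box 3 L)) => (∑ s' ∈ Finset.univ.filter (fun s' : SpinConfig ↥(box 3 L) => ∀ a : ↥(box 3 L), ¬ (a.1 0 + a.1 1 + a.1 2 ≤ -1) → s' a = s a), g s' * PairIsing.gibbsWeight (fun a b : ↥(box 3 L) => if (∑ i, |a.1 i - b.1 i| = 1) then criticalBeta 3 / 2 else (0:ℝ)) s') / (∑ s' ∈ Finset.univ.filter (fun s' : SpinConfig ↥(box 3 L) => ∀ a : ↥(box 3 L), ¬ (a.1 0 + a.1 1 + a.1 2 ≤ -1) → s' a = s a), PairIsing.gibbsWeight (fun a b : ↥(box 3 L) => if (∑ i, |a.1 i - b.1 i| = 1) then criticalBeta 3 / 2 else (0:ℝ)) s')) (fun s' => ∏ i, if old i then 1 else (if h : z i ∈ box 3 L then spinAt (⟨z i, h⟩ : ↥(box 3 L)) s' else 0)) s)) L k (fun i => w i 0 + w i 1 + w i 2 ≤ 0) (fun i => latticeApprox δ ((fun v : EuclideanSpace ℝ (Fin 3) => if v 0 + v 1 + v 2 ≤ 0 then v else (fun v : EuclideanSpace ℝ (Fin 3) => ((ℝ ∙ (EuclideanSpace.single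 0 1 + EuclideanSpace.single 1 1 + EuclideanSpace.single 2 1 : EuclideanSpace ℝ (Fin 3)))ᗮ).reflection v) v) (w i)))) Filter.atTop) :=
  stub_replicaAllUpperUniform

/-- **stub_responsePairing (S5b′ — RESPONSE-PAIRING FORM OF THE MIXED REPLICA MIRROR; OPEN, research-level).** For every
bulk datum `(ρ, S)` and every even order `k`: the renormalised PAIRING OF THE TWO LOWER-HALF-CRYSTAL RESPONSES
`ρ(δ)^k · limsup_L ⟨E_L[∏_{h wᵢ ≤ 0} σ_{[wᵢ/δ]} | 𝓕] · E_L[∏_{h wᵢ > 0} σ_{[θwᵢ/δ]} | 𝓕]⟩^∅_{box L; β_c(3)}` (`𝓕` = the spins off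
the resampled half-crystal `{h ≤ -1}`; both factors are functions of the plane layer `σ_P` by the Markov property, S5bAudit.lean
`condExp_markov`) converges to `S_k` LOCALLY UNIFORMLY on the mixed admissible configurations. By the factorisation
`replicaBox = ⟨m_old · m_new⟩` (tower + pull-out, `stub_mixedOfResponsePairing`) this IS the mixed replica mirror S5b-u with the
non-symmetric observable `∏_old σ · E[∏_new σ' | 𝓕]` replaced by the symmetric pairing. Against the bulk identity
`⟨σ_X σ_Y⟩ = ⟨m_X(σ_P) · m_{ιY}(σ_P ∘ ι)⟩` (`ι = -id`, `ιY = R θY`, `R` the in-plane half-turn, NOT a symmetry of the (111)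
half-crystal) the content is the asymptotic `R`-invariance of the response pairing = RG-irrelevance of the `R`-odd boundary
response (no two-body part; four-body leading, 2.7 % at lattice scale, crux NOTES.md §2.3). No finite-volume identity, no
correlation-inequality route, nothing in print. [cite: FrohlichEtAl1978, §3 Thm 3.1] [cite: KrishnanMetlitski2023, §1] -/
theorem stub_responsePairing :
    (fun (pairing : ℝ → (k : ℕ) → (Fin k → EuclideanSpace ℝ (Fin 3)) → ℝ) => ∀ (ρ : ℝ → ℝ) (S : CorrFamily 3), (∀ δ ∈ Set.Ioc (0:ℝ) 1, 0 < ρ δ) → HasPointwiseScalingLimit (criticalCorr 3) ρ S → IsNondegenerateTwoPoint S → ∀ (k : ℕ), Even k → TendstoLocallyUniformlyOn (fun (δ : ℝ) (w : Fin k → EuclideanSpace ℝ (Fin 3)) => ρ δ ^ k * pairing δ k w) (S k) (𝓝[>] (0:ℝ)) (NonCoincident 3 k ∩ {w | ∀ i, w i 0 + w i 1 + w i 2 ≠ 0} ∩ {w | (∃ i, 0 < w i 0 + w i 1 + w i 2) ∧ (∃ i, w i 0 + w i 1 + w i 2 < 0)})) (fun (δ : ℝ) (k : ℕ) (w : Fin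 k → EuclideanSpace ℝ (Fin 3)) => Filter.limsup (fun L : ℕ => (fun (L k : ℕ) (old : Fin k → Prop) (z : Fin k → Site 3) => PairIsing.gibbsAvg (fun a b : ↥(box 3 L) => if (∑ i, |a.1 i - b.1 i| = 1) then criticalBeta 3 / 2 else (0:ℝ)) (fun s => (fun (g : SpinConfig ↥(box 3 L) → ℝ) (s : SpinConfig ↥(box 3 L)) => (∑ s' ∈ Finset.univ.filter (fun s' : SpinConfig ↥(box 3 L) => ∀ a : ↥(box 3 L), ¬ (a.1 0 + a.1 1 + a.1 2 ≤ -1) → s' a = s a), g s' * PairIsing.gibbsWeight (fun a b : ↥(box 3 L) => if (∑ i, |a.1 i - b.1 i| = 1) then criticalBeta 3 / 2 else (0:ℝ)) s') / (∑ s' ∈ Finset.univ.filter (fun s' : SpinConfig ↥(box 3 L) => ∀ a : ↥(box 3 L), ¬ (a.1 0 + a.1 1 + a.1 2 ≤ -1) → s' a = s a), PairIsing.gibbsWeight (fun a b : ↥(box 3 L) => if (∑ i, |a.1 i - b.1 i| = 1) then criticalBeta 3 / 2 else (0:ℝ)) s')) (fun s' => ∏ i, if old i then (if h : z i ∈ box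 3 L then spinAt (⟨z i, h⟩ : ↥(box 3 L)) s' else 0) else 1) s * (fun (g : SpinConfig ↥(box 3 L) → ℝ) (s : SpinConfig ↥(box 3 L)) => (∑ s' ∈ Finset.univ.filter (fun s' : SpinConfig ↥(box 3 L) => ∀ a : ↥(box 3 L), ¬ (a.1 0 + a.1 1 + a.1 2 ≤ -1) → s' a = s a), g s' * PairIsing.gibbsWeight (fun a b : ↥(box 3 L) => if (∑ i, |a.1 i - b.1 i| = 1) then criticalBeta 3 / 2 else (0:ℝ)) s') / (∑ s' ∈ Finset.univ.filter (fun s' : SpinConfig ↥(box 3 L) => ∀ a : ↥(box 3 L), ¬ (a.1 0 + a.1 1 + a.1 2 ≤ -1) → s' a = s a), PairIsing.gibbsWeight (fun a b : ↥(box 3 L) => if (∑ i, |a.1 i - b.1 i| = 1) then criticalBeta 3 / 2 else (0:ℝ)) s')) (fun s' => ∏ i, if old i then 1 else (if h : z i ∈ box 3 L then spinAt (⟨z i, h⟩ : ↥(box 3 L)) s' else 0)) s)) L k (fun i => w i 0 + w i 1 + w i 2 ≤ 0) (fun i => latticeApprox δ ((fun v : EuclideanSpace ℝ (Fin 3) =>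 if v 0 + v 1 + v 2 ≤ 0 then v else (fun v : EuclideanSpace ℝ (Fin 3) => ((ℝ ∙ (EuclideanSpace.single 0 1 + EuclideanSpace.single 1 1 + EuclideanSpace.single 2 1 : EuclideanSpace ℝ (Fin 3)))ᗮ).reflection v) v) (w i)))) Filter.atTop) := by
  sorry

/-- **stub_mixedOfResponsePairing (S5b″ — THE MIXED REPLICA MIRROR FOLLOWS FROM THE RESPONSE-PAIRING FORM; provable now, size M).**
For every `L, k, old, z` the replica box correlator factorises EXACTLY as the Gibbs average of the product of the two exact
conditional expectations given the spins off `{h ≤ -1}`: `⟨(∏_old σ) · E[∏_new σ | 𝓕]⟩ = ⟨E[∏_old σ | 𝓕] · E[∏_new σ | 𝓕]⟩`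
(tower property + pull-out for the finite-volume Gibbs kernel: the class average is constant on classes and the classes
partition the configuration space), so the two renormalised families are the same function of `(δ, w)` and the locally uniform
statements coincide (`TendstoLocallyUniformlyOn.congr`). Kernel-checked in the crux workfile S5bAudit.lean
(`replicaBoxA_eq_gibbsAvg_condLow_mul_condLow`, `stub_replicaMirrorMixedUniform_of_responsePairing`); to be landed def-free.
[cite: FriedliVelenik2017, §6.2 (DLR consistency)] -/
theorem stub_mixedOfResponsePairing :
    (fun (replicaFold : ℝ → (k : ℕ) → (Fin k → EuclideanSpace ℝ (Fin 3)) → ℝ) (pairing : ℝ → (k : ℕ) → (Fin k → EuclideanSpace ℝ (Fin 3)) → ℝ) => (∀ (ρ : ℝ → ℝ) (S : CorrFamily 3), (∀ δ ∈ Set.Ioc (0:ℝ) 1, 0 < ρ δ) → HasPointwiseScalingLimit (criticalCorr 3) ρ S → IsNondegenerateTwoPoint S → ∀ (k : ℕ), Even k → TendstoLocallyUniformlyOn (fun (δ : ℝ) (w : Fin k → EuclideanSpace ℝ (Fin 3)) => ρ δ ^ k * pairing δ k w) (S k) (𝓝[>] (0:ℝ)) (NonCoincident 3 k ∩ {w |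 ∀ i, w i 0 + w i 1 + w i 2 ≠ 0} ∩ {w | (∃ i, 0 < w i 0 + w i 1 + w i 2) ∧ (∃ i, w i 0 + w i 1 + w i 2 < 0)})) → (∀ (ρ : ℝ → ℝ) (S : CorrFamily 3), (∀ δ ∈ Set.Ioc (0:ℝ) 1, 0 < ρ δ) → HasPointwiseScalingLimit (criticalCorr 3) ρ S → IsNondegenerateTwoPoint S → ∀ (k : ℕ), Even k → TendstoLocallyUniformlyOn (fun (δ : ℝ) (w : Fin k → EuclideanSpace ℝ (Fin 3)) => ρ δ ^ k * replicaFold δ k w) (S k) (𝓝[>] (0:ℝ)) (NonCoincident 3 k ∩ {w | ∀ i, w i 0 + w i 1 + w i 2 ≠ 0} ∩ {w | (∃ i, 0 < w i 0 + w i 1 + w i 2) ∧ (∃ i, w i 0 + w i 1 + w i 2 < 0)}))) (fun (δ : ℝ) (k : ℕ) (w : Fin k → EuclideanSpace ℝ (Fin 3)) => Filter.limsup (fun L : ℕ => (fun (L k : ℕ) (old : Fin k → Prop) (z : Fin k → Site 3) => PairIsing.gibbsAvg (fun a b : ↥(box 3 L) => if (∑ i, |a.1 i - b.1 i| = 1)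 then criticalBeta 3 / 2 else (0:ℝ)) (fun s => (∏ i, if old i then (if h : z i ∈ box 3 L then spinAt (⟨z i, h⟩ : ↥(box 3 L)) s else 0) else 1) * (fun (g : SpinConfig ↥(box 3 L) → ℝ) (s : SpinConfig ↥(box 3 L)) => (∑ s' ∈ Finset.univ.filter (fun s' : SpinConfig ↥(box 3 L) => ∀ a : ↥(box 3 L), ¬ (a.1 0 + a.1 1 + a.1 2 ≤ -1) → s' a = s a), g s' * PairIsing.gibbsWeight (fun a b : ↥(box 3 L) => if (∑ i, |a.1 i - b.1 i| = 1) then criticalBeta 3 / 2 else (0:ℝ)) s') / (∑ s' ∈ Finset.univ.filter (fun s' : SpinConfig ↥(box 3 L) => ∀ a : ↥(box 3 L), ¬ (a.1 0 + a.1 1 + a.1 2 ≤ -1) → s' a = s a), PairIsing.gibbsWeight (fun a b : ↥(box 3 L) => if (∑ i, |a.1 i - b.1 i| = 1) then criticalBeta 3 / 2 else (0:ℝ)) s')) (fun s' => ∏ i, if old i then 1 else (if h : z i ∈ box 3 L then spinAt (⟨z i, h⟩ : ↥(box 3 L)) s' else 0)) s)) L k (fun i => w i 0 + w i 1 + w i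 2 ≤ 0) (fun i => latticeApprox δ ((fun v : EuclideanSpace ℝ (Fin 3) => if v 0 + v 1 + v 2 ≤ 0 then v else (fun v : EuclideanSpace ℝ (Fin 3) => ((ℝ ∙ (EuclideanSpace.single 0 1 + EuclideanSpace.single 1 1 + EuclideanSpace.single 2 1 : EuclideanSpace ℝ (Fin 3)))ᗮ).reflection v) v) (w i)))) Filter.atTop) (fun (δ : ℝ) (k : ℕ) (w : Fin k → EuclideanSpace ℝ (Fin 3)) => Filter.limsup (fun L : ℕ => (fun (L k : ℕ) (old : Fin k → Prop) (z : Fin k → Site 3) => PairIsing.gibbsAvg (fun a b : ↥(box 3 L) => if (∑ i, |a.1 i - b.1 i| = 1) then criticalBeta 3 / 2 else (0:ℝ)) (fun s => (fun (g : SpinConfig ↥(box 3 L) → ℝ) (s : SpinConfig ↥(box 3 L)) => (∑ s' ∈ Finset.univ.filter (fun s' : SpinConfig ↥(box 3 L) => ∀ a : ↥(box 3 L), ¬ (a.1 0 + a.1 1 + a.1 2 ≤ -1) → s' a = s a), g s' * PairIsing.gibbsWeight (fun a b : ↥(box 3 L) => if (∑ i, |a.1 i - b.1 i| = 1) then criticalBeta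 3 / 2 else (0:ℝ)) s') / (∑ s' ∈ Finset.univ.filter (fun s' : SpinConfig ↥(box 3 L) => ∀ a : ↥(box 3 L), ¬ (a.1 0 + a.1 1 + a.1 2 ≤ -1) → s' a = s a), PairIsing.gibbsWeight (fun a b : ↥(box 3 L) => if (∑ i, |a.1 i - b.1 i| = 1) then criticalBeta 3 / 2 else (0:ℝ)) s')) (fun s' => ∏ i, if old i then (if h : z i ∈ box 3 L then spinAt (⟨z i, h⟩ : ↥(box 3 L)) s' else 0) else 1) s * (fun (g : SpinConfig ↥(box 3 L) → ℝ) (s : SpinConfig ↥(box 3 L)) => (∑ s' ∈ Finset.univ.filter (fun s' : SpinConfig ↥(box 3 L) => ∀ a : ↥(box 3 L), ¬ (a.1 0 + a.1 1 + a.1 2 ≤ -1) → s' a = s a), g s' * PairIsing.gibbsWeight (fun a b : ↥(box 3 L) => if (∑ i, |a.1 i - b.1 i| = 1) then criticalBeta 3 / 2 else (0:ℝ)) s') / (∑ s' ∈ Finset.univ.filter (fun s' : SpinConfig ↥(box 3 L) => ∀ a : ↥(box 3 L), ¬ (a.1 0 + a.1 1 + a.1 2 ≤ -1) → s' a = s a),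 PairIsing.gibbsWeight (fun a b : ↥(box 3 L) => if (∑ i, |a.1 i - b.1 i| = 1) then criticalBeta 3 / 2 else (0:ℝ)) s')) (fun s' => ∏ i, if old i then 1 else (if h : z i ∈ box 3 L then spinAt (⟨z i, h⟩ : ↥(box 3 L)) s' else 0)) s)) L k (fun i => w i 0 + w i 1 + w i 2 ≤ 0) (fun i => latticeApprox δ ((fun v : EuclideanSpace ℝ (Fin 3) => if v 0 + v 1 + v 2 ≤ 0 then v else (fun v : EuclideanSpace ℝ (Fin 3) => ((ℝ ∙ (EuclideanSpace.single 0 1 + EuclideanSpace.single 1 1 + EuclideanSpace.single 2 1 : EuclideanSpace ℝ (Fin 3)))ᗮ).reflection v) v) (w i)))) Filter.atTop) := by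
  sorry

/-- **stub_twinIsReplicaEvenUniform (S6-u — AT A PLANE-CRITICAL SEAM COUPLING THE TWIN'S PLANE SECTOR IS THE BULK'S,
locally uniformly; OPEN, the defect physics, hardest, held by the lead).** For `(ρ, S)` as in the crux and every `J`
with `PlaneCritical J` (`0 < J`, slab susceptibility `= ⊤`, no plane long-range order — every continuous threshold is
such a `J` by the landed S3), for even `k ≥ 2`: `ρ(δ)^k (twinCorr J δ k − replicaFold δ k) → 0` LOCALLY UNIFORMLY on
the admissible set (non-coincident, no point on the plane). The tuned twin and the replica twin are two Markov doubles
of the same half-crystal pages reading the same sites — `E_{ν_TW,J}[m^J_X m^J_Y]` against `E_{ν_bulk}[m_X m_Y]`: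
plane-law universality at the threshold. ISOTROPY-FREE. This v4 form absorbs the former equicontinuity stub S7 (local
uniformity is not easier than convergence: S7's open content was a hypothesis-free lattice Harnack inequality for the
twin, S7Audit.lean). Why it might fail: a relevant even plane coupling at `J*` (transparent coupling ≠ plane-critical
coupling), or a non-trivial `θ`-symmetric plane-critical conformal interface of the 3D Ising class (barrier
RigorousRGSmallParameter: defect irrelevance at the n.n. critical point, no small parameter). Numerics (crux NOTES.md,
kit j025040): `J*_TW = 1.000 ± 0.003`, pairwise transparency couplings `1.000 ± 0.002`, `κ = 1.00 ± 0.02`.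
[cite: KrishnanMetlitski2023, §1] [cite: BurkhardtEisenriegler1981] [cite: BrayMoore1977] -/
theorem stub_twinIsReplicaEvenUniform :
    (fun (twinCorr : ℝ → ℝ → (k : ℕ) → (Fin k → EuclideanSpace ℝ (Fin 3)) → ℝ) (replicaFold : ℝ → (k : ℕ) → (Fin k → EuclideanSpace ℝ (Fin 3)) → ℝ) (PlaneCritical : ℝ → Prop) => ∀ (ρ : ℝ → ℝ) (S : CorrFamily 3), (∀ δ ∈ Set.Ioc (0:ℝ) 1, 0 < ρ δ) → HasPointwiseScalingLimit (criticalCorr 3) ρ S → IsNondegenerateTwoPoint S → ∀ J : ℝ, PlaneCritical J → ∀ (k : ℕ), Even k → k ≠ 0 → TendstoLocallyUniformlyOn (fun (δ : ℝ) (w : Fin k → EuclideanSpace ℝ (Fin 3)) => ρ δ ^ k * twinCorr J δ k w - ρ δ ^ k * replicaFold δ k w) (fun _ => (0:ℝ)) (𝓝[>] (0:ℝ)) (NonCoincident 3 k ∩ {w | ∀ i, w i 0 + w i 1 + w i 2 ≠ 0})) (fun (J δ : ℝ) (k : ℕ) (w : Fin k → EuclideanSpace ℝ (Fin 3)) =>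 (fun (J : ℝ) (k : ℕ) (z : Fin k → Site 3) => ⨆ L : ℕ, PairIsing.gibbsAvg (fun a b : ↥(box 3 L) => if (((∑ i, |a.1 i - b.1 i| = 1) ∧ ¬ ((a.1 0 + a.1 1 + a.1 2 = 0 ∧ b.1 0 + b.1 1 + b.1 2 = 1) ∨ (a.1 0 + a.1 1 + a.1 2 = 1 ∧ b.1 0 + b.1 1 + b.1 2 = 0))) ∨ (((a.1 0 + a.1 1 + a.1 2 = 0 ∧ b.1 0 + b.1 1 + b.1 2 = 1) ∨ (a.1 0 + a.1 1 + a.1 2 = 1 ∧ b.1 0 + b.1 1 + b.1 2 = 0)) ∧ ∃ i : Fin 3, a.1 + b.1 = Pi.single i 1)) then (criticalBeta 3 / 2) * (if a.1 0 + a.1 1 + a.1 2 = 0 ∨ b.1 0 + b.1 1 + b.1 2 = 0 then J else 1) else 0) (fun s => ∏ i, if h : z i ∈ box 3 L then spinAt (⟨z i, h⟩ : ↥(box 3 L)) s else 0)) J k (fun i => (fun (δ : ℝ) (v : EuclideanSpace ℝ (Fin 3)) => if v 0 + v 1 + v 2 ≤ 0 then latticeApprox δ v else -latticeApprox δ ((fun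 v : EuclideanSpace ℝ (Fin 3) => ((ℝ ∙ (EuclideanSpace.single 0 1 + EuclideanSpace.single 1 1 + EuclideanSpace.single 2 1 : EuclideanSpace ℝ (Fin 3)))ᗮ).reflection v) v)) δ (w i))) (fun (δ : ℝ) (k : ℕ) (w : Fin k → EuclideanSpace ℝ (Fin 3)) => Filter.limsup (fun L : ℕ => (fun (L k : ℕ) (old : Fin k → Prop) (z : Fin k → Site 3) => PairIsing.gibbsAvg (fun a b : ↥(box 3 L) => if (∑ i, |a.1 i - b.1 i| = 1) then criticalBeta 3 / 2 else (0:ℝ)) (fun s => (∏ i, if old i then (if h : z i ∈ box 3 L then spinAt (⟨z i, h⟩ : ↥(box 3 L)) s else 0) else 1) * (fun (g : SpinConfig ↥(box 3 L) → ℝ) (s : SpinConfig ↥(box 3 L)) => (∑ s' ∈ Finset.univ.filter (fun s' : SpinConfig ↥(box 3 L) => ∀ a : ↥(box 3 L), ¬ (a.1 0 + a.1 1 + a.1 2 ≤ -1) → s' a = s a), g s' * PairIsing.gibbsWeight (fun a b : ↥(box 3 L) => if (∑ i, |a.1 i - b.1 i| = 1) then criticalBeta 3 / 2 else (0:ℝ))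 s') / (∑ s' ∈ Finset.univ.filter (fun s' : SpinConfig ↥(box 3 L) => ∀ a : ↥(box 3 L), ¬ (a.1 0 + a.1 1 + a.1 2 ≤ -1) → s' a = s a), PairIsing.gibbsWeight (fun a b : ↥(box 3 L) => if (∑ i, |a.1 i - b.1 i| = 1) then criticalBeta 3 / 2 else (0:ℝ)) s')) (fun s' => ∏ i, if old i then 1 else (if h : z i ∈ box 3 L then spinAt (⟨z i, h⟩ : ↥(box 3 L)) s' else 0)) s)) L k (fun i => w i 0 + w i 1 + w i 2 ≤ 0) (fun i => latticeApprox δ ((fun v : EuclideanSpace ℝ (Fin 3) => if v 0 + v 1 + v 2 ≤ 0 then v else (fun v : EuclideanSpace ℝ (Fin 3) => ((ℝ ∙ (EuclideanSpace.single 0 1 + EuclideanSpace.single 1 1 + EuclideanSpace.single 2 1 : EuclideanSpace ℝ (Fin 3)))ᗮ).reflection v) v) (w i)))) Filter.atTop) (fun J : ℝ => 0 < J ∧ (fun J : ℝ => ⨆ x : {y : Site 3 // (-1 ≤ y 0 + y 1 + y 2 ∧ y 0 + y 1 + y 2 ≤ 1)}, ∑' y : {y : Site 3 // (-1 ≤ y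 0 + y 1 + y 2 ∧ y 0 + y 1 + y 2 ≤ 1)}, ENNReal.ofReal ((fun (J : ℝ) (k : ℕ) (z : Fin k → Site 3) => ⨆ L : ℕ, PairIsing.gibbsAvg (fun a b : ↥(box 3 L) => if (((∑ i, |a.1 i - b.1 i| = 1) ∧ ¬ ((a.1 0 + a.1 1 + a.1 2 = 0 ∧ b.1 0 + b.1 1 + b.1 2 = 1) ∨ (a.1 0 + a.1 1 + a.1 2 = 1 ∧ b.1 0 + b.1 1 + b.1 2 = 0))) ∨ (((a.1 0 + a.1 1 + a.1 2 = 0 ∧ b.1 0 + b.1 1 + b.1 2 = 1) ∨ (a.1 0 + a.1 1 + a.1 2 = 1 ∧ b.1 0 + b.1 1 + b.1 2 = 0)) ∧ ∃ i : Fin 3, a.1 + b.1 = Pi.single i 1)) then (criticalBeta 3 / 2) * (if a.1 0 + a.1 1 + a.1 2 = 0 ∨ b.1 0 + b.1 1 + b.1 2 = 0 then J else 1) else 0) (fun s => ∏ i, if h : z i ∈ box 3 L then spinAt (⟨z i, h⟩ : ↥(box 3 L)) s else 0)) J 2 ![x.1, y.1])) J = ⊤ ∧ ¬ (fun J : ℝ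 => ∃ m : ℝ, 0 < m ∧ ∀ c : Site 3, c 0 + c 1 + c 2 = 0 → m ≤ (fun (J : ℝ) (k : ℕ) (z : Fin k → Site 3) => ⨆ L : ℕ, PairIsing.gibbsAvg (fun a b : ↥(box 3 L) => if (((∑ i, |a.1 i - b.1 i| = 1) ∧ ¬ ((a.1 0 + a.1 1 + a.1 2 = 0 ∧ b.1 0 + b.1 1 + b.1 2 = 1) ∨ (a.1 0 + a.1 1 + a.1 2 = 1 ∧ b.1 0 + b.1 1 + b.1 2 = 0))) ∨ (((a.1 0 + a.1 1 + a.1 2 = 0 ∧ b.1 0 + b.1 1 + b.1 2 = 1) ∨ (a.1 0 + a.1 1 + a.1 2 = 1 ∧ b.1 0 + b.1 1 + b.1 2 = 0)) ∧ ∃ i : Fin 3, a.1 + b.1 = Pi.single i 1)) then (criticalBeta 3 / 2) * (if a.1 0 + a.1 1 + a.1 2 = 0 ∨ b.1 0 + b.1 1 + b.1 2 = 0 then J else 1) else 0) (fun s => ∏ i, if h : z i ∈ box 3 L then spinAt (⟨z i, h⟩ : ↥(box 3 L)) s else 0)) J 2 ![0, c]) J) := by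
  sorry


/-! ## §4 Proved here: isotropy for EVERY datum; the trivial orders `k = 0` and odd `k` -/

/-- **`θ`-invariance of every pointwise limit datum on non-coincident configurations.** For every `(ρ, S)` with
`ρ > 0` on `(0,1]`, `HasPointwiseScalingLimit (criticalCorr 3) ρ S` and `S₂ > 0`: the normalised family is
translation invariant (`isTranslationInvariant_normalised_of_limit`), scale covariant with some `Δ' ∈ [1/2,1]`
(`exists_scaleCovariant_normalised`) and a non-degenerate limit datum (`normalised_hasLimit`, `normalised_nondeg`),
hence `O(3)`-invariant (`limitRotationInvariant_proof ∘ HRP2Rigidity_of`); `θ` is a linear isometry preserving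
`NonCoincident`. (v1's `FirstLemma.AutomaticNiceness` + `theta_invariance_of_nice`, now a theorem; used inside the
landed S5a.) [folklore] -/
theorem theta_invariance_of_limit (ρ : ℝ → ℝ) (S : CorrFamily 3)
    (hρ : ∀ δ ∈ Set.Ioc (0:ℝ) 1, 0 < ρ δ) (hlim : HasPointwiseScalingLimit (criticalCorr 3) ρ S)
    (hnd : IsNondegenerateTwoPoint S) :
    ∀ (k : ℕ), ∀ w ∈ NonCoincident 3 k, S k (fun i => thetaC (w i)) = S k w := by
  obtain ⟨Δ', -, hsc'⟩ :=
    Summit.CriticalPhenomena.Ising3DConformalLimit.MoebiusLimitExistsNegative.exists_scaleCovariant_normalised hρ hlim hnd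
  have hlim' := Summit.CriticalPhenomena.Ising3DConformalLimit.MoebiusLimitExistsNegative.normalised_hasLimit hlim
  have hnd' := Summit.CriticalPhenomena.Ising3DConformalLimit.MoebiusLimitExistsNegative.normalised_nondeg hnd
  have htr' :=
    Summit.CriticalPhenomena.Ising3DConformalLimit.MoebiusLimitExistsNegative.isTranslationInvariant_normalised_of_limit hlim
  have hnorm' : ∀ n z, z ∉ NonCoincident 3 n →
      (fun n x => if x ∈ NonCoincident 3 n then S n x else 0) n z = 0 := fun n z hz => if_neg hz
  have hrot : IsRotationInvariant (fun n x => if x ∈ NonCoincident 3 n then S n x else 0) :=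
    Summit.CriticalPhenomena.Ising3DConformalLimit.Cruxes.LimitRotationInvariant.QuarterTurnLiouville.limitRotationInvariant_proof
      Summit.CriticalPhenomena.Ising3DConformalLimit.Cruxes.HRP2Rigidity.XRayMellin.HRP2Rigidity_of
      ρ Δ' _ hρ hlim' hnorm' hnd' htr' hsc'
  intro k w hw
  have hθw : (fun i => thetaC (w i)) ∈ NonCoincident 3 k := by
    rw [mem_nonCoincident] at hw ⊢
    intro i j hij
    exact hw (((ℝ ∙ (EuclideanSpace.single 0 1 + EuclideanSpace.single 1 1 + EuclideanSpace.single 2 1 : EuclideanSpace ℝ (Fin 3)))ᗮ.reflection).injective hij)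
  have h := hrot k ((ℝ ∙ (EuclideanSpace.single 0 1 + EuclideanSpace.single 1 1 + EuclideanSpace.single 2 1 : EuclideanSpace ℝ (Fin 3)))ᗮ.reflection) w
  dsimp only at h
  rw [if_pos hw, if_pos (show (fun i => ((ℝ ∙ (EuclideanSpace.single 0 1 + EuclideanSpace.single 1 1 + EuclideanSpace.single 2 1 : EuclideanSpace ℝ (Fin 3)))ᗮ.reflection) (w i)) ∈ NonCoincident 3 k from hθw)] at h
  exact h

/-- **Order `0`: the twin correlator is the constant `1`** (`⨆_L ⟨1⟩ = 1`). [folklore] -/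
theorem twinLatC_zero (J : ℝ) (z : Fin 0 → Site 3) : twinLatC J 0 z = 1 := by
  rw [twinLatC_eq_iSup]
  have h : (fun L => twinBoxC J L 0 z) = fun _ => 1 := by
    funext L
    unfold twinBoxC
    simp only [Finset.univ_eq_empty, Finset.prod_empty]
    exact PairIsing.gibbsAvg_const _ 1
  rw [h, ciSup_const]

/-- Order `0` for `twinCorrC`. [folklore] -/
theorem twinCorrC_zero_eq_one (J δ : ℝ) (w : Fin 0 → E) : twinCorrC J δ 0 w = 1 :=
  twinLatC_zero J _

/-- **Odd box monomials average to zero** in every free twin box: the global spin flip `s ↦ -s` preserves the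
pair Boltzmann weight and negates `∏ᵢ σ_{zᵢ}` for odd `k` (junk factor `0` included; `gibbsAvg_eq_zero_of_flipOn`
with the trivial cut). [cite: FriedliVelenik2017, §3.6] -/
theorem twinBoxC_odd_eq_zero (J : ℝ) (L k : ℕ) (z : Fin k → Site 3) (hk : Odd k) : twinBoxC J L k z = 0 := by
  unfold twinBoxC
  refine gibbsAvg_eq_zero_of_flipOn (fun _ => True) _ (fun a b _ hb => (hb trivial).elim) _ fun s => ?_
  have hterm : ∀ i : Fin k, (if h : z i ∈ box 3 L then spinAt (⟨z i, h⟩ : ↥(box 3 L))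
      (fun b => if True then -s b else s b) else 0 : ℝ) =
      -(if h : z i ∈ box 3 L then spinAt (⟨z i, h⟩ : ↥(box 3 L)) s else 0) := by
    intro i
    by_cases h : z i ∈ box 3 L
    · rw [dif_pos h, dif_pos h, spinAt_flipOn, if_pos trivial]
    · rw [dif_neg h, dif_neg h, neg_zero]
  rw [Finset.prod_congr rfl fun i _ => hterm i, Finset.prod_neg, Finset.card_univ, Fintype.card_fin,
    hk.neg_one_pow, neg_one_mul]

/-- Hence the sup over boxes vanishes at odd order. [folklore] -/
theorem twinLatC_odd_eq_zero (J : ℝ) (k : ℕ) (z : Fin k → Site 3) (hk : Odd k) : twinLatC J k z = 0 := by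
  rw [twinLatC_eq_iSup]
  simp only [twinBoxC_odd_eq_zero J _ k z hk, ciSup_const]

/-- At odd order the twin correlator of the crux vanishes identically. [folklore] -/
theorem twinCorrC_odd_eq_zero (J δ : ℝ) (k : ℕ) (w : Fin k → E) (hk : Odd k) : twinCorrC J δ k w = 0 :=
  twinLatC_odd_eq_zero J k _ hk

/-- The critical `0`-point correlator is `1` (`plusExpect_one`). [folklore] -/
theorem criticalCorr_three_zero (x : Fin 0 → Site 3) : criticalCorr 3 0 x = 1 := by
  have h : spinMonomial x = fun _ => (1:ℝ) := by
    funext s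
    simp [spinMonomial]
  show plusExpect 3 (criticalBeta 3) 0 (spinMonomial x) = 1
  rw [h]
  exact plusExpect_one (d := 3) _ _

/-- **Order `0` of every limit datum is `1`** (`S₀ = lim 1`). [folklore] -/
theorem limit_zero_eq_one {ρ : ℝ → ℝ} {S : CorrFamily 3} (hlim : HasPointwiseScalingLimit (criticalCorr 3) ρ S)
    (w : Fin 0 → E) : S 0 w = 1 := by
  have hw : w ∈ NonCoincident 3 0 := by
    rw [mem_nonCoincident]
    intro i
    exact i.elim0
  have h := (hlim 0).tendsto_at hw
  have h1 : Tendsto (fun δ => rescaledCorrelator (criticalCorr 3) ρ 0 δ w) (𝓝[>] (0:ℝ)) (𝓝 1) := by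
    refine tendsto_const_nhds.congr fun δ => ?_
    rw [rescaledCorrelator_apply, pow_zero, one_mul, criticalCorr_three_zero]
  exact tendsto_nhds_unique h h1

/-! ## §5 General topology (proved; identical to v1 / line `birth`) -/

/-- Pointwise convergence plus asymptotic local equicontinuity give locally uniform convergence. [folklore] -/
theorem tendstoLocallyUniformlyOn_of_forall_tendsto_of_equicontinuous
    {X ι : Type*} [TopologicalSpace X] {p : Filter ι} [p.NeBot]
    {F : ι → X → ℝ} {f : X → ℝ} {s : Set X}
    (hpt : ∀ x ∈ s, Tendsto (fun i => F i x) p (𝓝 (f x)))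
    (heq : ∀ x ∈ s, ∀ ε > (0:ℝ), ∃ t ∈ 𝓝[s] x, ∀ᶠ i in p, ∀ y ∈ t, |F i y - F i x| ≤ ε) :
    TendstoLocallyUniformlyOn F f p s := by
  rw [Metric.tendstoLocallyUniformlyOn_iff]
  intro ε hε x hx
  obtain ⟨t, ht, hev⟩ := heq x hx (ε / 4) (by positivity)
  refine ⟨t ∩ s, inter_mem ht self_mem_nhdsWithin, ?_⟩
  have hx4 : ∀ᶠ i in p, |F i x - f x| < ε / 4 := by
    have h := hpt x hx
    rw [Metric.tendsto_nhds] at h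
    simpa only [Real.dist_eq] using h (ε / 4) (by positivity)
  filter_upwards [hev, hx4] with i hi hix
  rintro y ⟨hyt, hys⟩
  have hfy : |f y - f x| ≤ ε / 4 := by
    have hlim : Tendsto (fun j => |F j y - F j x|) p (𝓝 (|f y - f x|)) :=
      ((hpt y hys).sub (hpt x hx)).abs
    exact le_of_tendsto hlim (hev.mono fun j hj => hj y hyt)
  rw [Real.dist_eq]
  calc |f y - F i y| = |(f y - f x) + (f x - F i x) + (F i x - F i y)| := by congr 1; ring
    _ ≤ |f y - f x| + |f x - F i x| + |F i x - F i y| := abs_add_three _ _ _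
    _ < ε := by
        have h1 : |f x - F i x| < ε / 4 := by rw [abs_sub_comm]; exact hix
        have h2 : |F i x - F i y| ≤ ε / 4 := by rw [abs_sub_comm]; exact hi y hyt
        linarith


/-! ## §6 The composition (no `sorry`) -/

/-- Coordinates of the height `w ↦ wᵢ₀ + wᵢ₁ + wᵢ₂` are continuous on configuration space. [folklore] -/
theorem continuous_height {k : ℕ} (i : Fin k) : Continuous fun w : Fin k → E => w i 0 + w i 1 + w i 2 := by
  have h : ∀ j : Fin 3, Continuous fun w : Fin k → E => w i j := fun j =>
    (PiLp.continuous_apply 2 (fun _ : Fin 3 => ℝ) j).comp (continuous_apply i)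
  exact ((h 0).add (h 1)).add (h 2)

/-- The all-lower configurations form an open set. [folklore] -/
theorem isOpen_allLower (k : ℕ) : IsOpen {w : Fin k → E | ∀ i, w i 0 + w i 1 + w i 2 < 0} := by
  simp only [setOf_forall]
  exact isOpen_iInter_of_finite fun i => isOpen_lt (continuous_height i) continuous_const

/-- The all-upper configurations form an open set. [folklore] -/
theorem isOpen_allUpper (k : ℕ) : IsOpen {w : Fin k → E | ∀ i, 0 < w i 0 + w i 1 + w i 2} := by
  simp only [setOf_forall]
  exact isOpen_iInter_of_finite fun i => isOpen_lt continuous_const (continuous_height i)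

/-- The configurations with no point on the plane form an open set. [folklore] -/
theorem isOpen_offPlane (k : ℕ) : IsOpen {w : Fin k → E | ∀ i, w i 0 + w i 1 + w i 2 ≠ 0} := by
  simp only [setOf_forall]
  exact isOpen_iInter_of_finite fun i => isOpen_ne_fun (continuous_height i) continuous_const

/-- The mixed configurations (a point strictly above and a point strictly below) form an open set. [folklore] -/
theorem isOpen_mixed (k : ℕ) :
    IsOpen {w : Fin k → E | (∃ i, 0 < w i 0 + w i 1 + w i 2) ∧ (∃ i, w i 0 + w i 1 + w i 2 < 0)} := by
  have h1 : IsOpen {w : Fin k → E | ∃ i, 0 < w i 0 + w i 1 + w i 2} := by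
    rw [setOf_exists]
    exact isOpen_iUnion fun i => isOpen_lt continuous_const (continuous_height i)
  have h2 : IsOpen {w : Fin k → E | ∃ i, w i 0 + w i 1 + w i 2 < 0} := by
    rw [setOf_exists]
    exact isOpen_iUnion fun i => isOpen_lt (continuous_height i) continuous_const
  exact h1.inter h2

/-- **The line closes the crux, reading map pinned to the identity (v4).** Landed S3 (fed landed S1, S2) makes the
threshold plane-critical; orders `k = 0` and odd `k` are constant (`1`, `0`) and match the limit; for even `k ≥ 2` the
replica part converges to `S_k` locally uniformly on the admissible set — on the three open pieces all-below (landed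
S4u) / all-above (landed S5au) / mixed (open S5b′ through the factorisation S5b″), glued by `TendstoLocallyUniformlyOn.union` — and the defect part
`ρ^k (twinCorr − replicaFold)` tends to `0` locally uniformly (S6-u); their sum is the claim. `A := LinearMap.id`;
`twinTransparency_iff` concludes the route decl BY NAME. [folklore] -/
theorem TwinTransparency_of (h5p : Sig.stub_responsePairing) (h5m : Sig.stub_mixedOfResponsePairing)
    (h6 : Sig.stub_twinIsReplicaEvenUniform) :
    Summit.CriticalPhenomena.Ising3DConformalLimit.Theses.ReflectionTwin.TwinTransparency := by
  rw [twinTransparency_iff]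
  intro ρ S hρ hlim hnd J hJ
  -- the threshold is plane-critical (landed S3 ∘ S1 ∘ S2, plus the two clauses of the threshold it keeps)
  have hPC : PlaneCriticalC J := by
    rw [planeCriticalC_iff]
    rw [isSeamThresholdC_iff] at hJ
    exact ⟨hJ.1, stub_thresholdNotCut stub_twinBoxMonotone stub_seamLebowitzIncrement J
      ((isSeamThresholdC_iff J).2 hJ), hJ.2.1⟩
  refine ⟨LinearMap.id, fun v _ => rfl, fun v hv => hv, fun k => ?_⟩
  have hfun : (fun w : Fin k → E => S k (fun i => if w i 0 + w i 1 + w i 2 ≤ 0 then w i else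
      (LinearMap.id : E →ₗ[ℝ] E) (w i))) = S k := by
    funext w
    congr 1
    funext i
    simp
  rw [hfun]
  rcases Nat.even_or_odd k with hk | hk
  swap
  · -- odd order: the twin correlator is identically `0` and so is the limit
    refine tendstoLocallyUniformlyOn_of_forall_tendsto_of_equicontinuous (fun w hw => ?_) (fun x _ ε hε => ?_)
    · rw [HasPointwiseScalingLimit.eq_zero_of_odd le_rfl hlim hk hw.1]
      refine tendsto_const_nhds.congr fun δ => ?_
      show (0:ℝ) = ρ δ ^ k * twinCorrC J δ k w
      rw [twinCorrC_odd_eq_zero J δ k w hk, mul_zero]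
    · refine ⟨univ, univ_mem, Eventually.of_forall fun δ y _ => ?_⟩
      show |ρ δ ^ k * twinCorrC J δ k y - ρ δ ^ k * twinCorrC J δ k x| ≤ ε
      rw [twinCorrC_odd_eq_zero J δ k y hk, twinCorrC_odd_eq_zero J δ k x hk, sub_self, abs_zero]
      exact hε.le
  by_cases hk0 : k = 0
  · -- order `0`: the constant `1`
    subst hk0
    refine tendstoLocallyUniformlyOn_of_forall_tendsto_of_equicontinuous (fun w _ => ?_) (fun x _ ε hε => ?_)
    · rw [limit_zero_eq_one hlim w]
      refine tendsto_const_nhds.congr fun δ => ?_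
      show (1:ℝ) = ρ δ ^ 0 * twinCorrC J δ 0 w
      rw [pow_zero, one_mul, twinCorrC_zero_eq_one]
    · refine ⟨univ, univ_mem, Eventually.of_forall fun δ y _ => ?_⟩
      show |ρ δ ^ 0 * twinCorrC J δ 0 y - ρ δ ^ 0 * twinCorrC J δ 0 x| ≤ ε
      rw [twinCorrC_zero_eq_one J δ y, twinCorrC_zero_eq_one J δ x, sub_self, abs_zero]
      exact hε.le
  -- even order `k ≥ 2`: replica part (S4u / S5au / S5b-u on three open pieces) + defect part (S6-u)
  have hR : TendstoLocallyUniformlyOn (fun (δ : ℝ) (w : Fin k → E) => ρ δ ^ k * replicaFoldC δ k w) (S k)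
      (𝓝[>] (0:ℝ)) (NonCoincident 3 k ∩ {w | ∀ i, w i 0 + w i 1 + w i 2 ≠ 0}) := by
    have hlow : TendstoLocallyUniformlyOn (fun (δ : ℝ) (w : Fin k → E) => ρ δ ^ k * replicaFoldC δ k w) (S k)
        (𝓝[>] (0:ℝ)) (NonCoincident 3 k ∩ {w | ∀ i, w i 0 + w i 1 + w i 2 < 0}) := stub_replicaLowerUniform ρ S hlim k
    have hup : TendstoLocallyUniformlyOn (fun (δ : ℝ) (w : Fin k → E) => ρ δ ^ k * replicaFoldC δ k w) (S k)
        (𝓝[>] (0:ℝ)) (NonCoincident 3 k ∩ {w | ∀ i, 0 < w i 0 + w i 1 + w i 2}) := stub_replicaAllUpperUniform ρ S hρ hlim hnd k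
    have hmix : TendstoLocallyUniformlyOn (fun (δ : ℝ) (w : Fin k → E) => ρ δ ^ k * replicaFoldC δ k w) (S k)
        (𝓝[>] (0:ℝ)) (NonCoincident 3 k ∩ {w | ∀ i, w i 0 + w i 1 + w i 2 ≠ 0} ∩
          {w | (∃ i, 0 < w i 0 + w i 1 + w i 2) ∧ (∃ i, w i 0 + w i 1 + w i 2 < 0)}) := h5m h5p ρ S hρ hlim hnd k hk
    have hU := (hlow.union ((isOpen_nonCoincident 3 k).inter (isOpen_allLower k))
      ((isOpen_nonCoincident 3 k).inter (isOpen_allUpper k)) hup).union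
      (((isOpen_nonCoincident 3 k).inter (isOpen_allLower k)).union
        ((isOpen_nonCoincident 3 k).inter (isOpen_allUpper k)))
      (((isOpen_nonCoincident 3 k).inter (isOpen_offPlane k)).inter (isOpen_mixed k)) hmix
    refine hU.mono fun w hw => ?_
    by_cases hup' : ∃ i, 0 < w i 0 + w i 1 + w i 2
    · by_cases hdown : ∃ i, w i 0 + w i 1 + w i 2 < 0
      · exact Or.inr ⟨hw, hup', hdown⟩
      · exact Or.inl (Or.inr ⟨hw.1, fun i => (lt_or_gt_of_ne (hw.2 i)).resolve_left fun h => hdown ⟨i, h⟩⟩)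
    · exact Or.inl (Or.inl ⟨hw.1, fun i => (lt_or_gt_of_ne (hw.2 i)).resolve_right fun h => hup' ⟨i, h⟩⟩)
  have hD : TendstoLocallyUniformlyOn
      (fun (δ : ℝ) (w : Fin k → E) => ρ δ ^ k * twinCorrC J δ k w - ρ δ ^ k * replicaFoldC δ k w) (fun _ => (0:ℝ))
      (𝓝[>] (0:ℝ)) (NonCoincident 3 k ∩ {w | ∀ i, w i 0 + w i 1 + w i 2 ≠ 0}) := h6 ρ S hρ hlim hnd J hPC k hk hk0
  have hsum := hD.add hR
  refine (hsum.congr fun δ w _ => ?_).congr_right fun w _ => ?_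
  · show ρ δ ^ k * twinCorrC J δ k w - ρ δ ^ k * replicaFoldC δ k w + ρ δ ^ k * replicaFoldC δ k w =
      ρ δ ^ k * twinCorrC J δ k w
    ring
  · show (0:ℝ) + S k w = S k w
    exact zero_add _

/-- **The registered stubs discharge the hypotheses of `TwinTransparency_of` verbatim.** [folklore] -/
theorem TwinTransparency_of_stubs :
    Summit.CriticalPhenomena.Ising3DConformalLimit.Theses.ReflectionTwin.TwinTransparency :=
  TwinTransparency_of stub_responsePairing stub_mixedOfResponsePairing stub_twinIsReplicaEvenUniform

end Summit.CriticalPhenomena.Ising3DConformalLimit.Cruxes.TwinTransparency.ReplicaMirror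

end
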